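import Literature.Probability.Percolation.FlipFourArm
import Literature.Probability.Percolation.ArmEventsStructure
import Literature.Probability.Percolation.SepArmsGlue
import Literature.Probability.Percolation.ArmSeparationUntwistFour
import Literature.Probability.Percolation.SepFourAdj
import HarnessLib

/-!
# Colour exchange for five arms: the double-exploration flip `(B,W,W,W,W) → (B,W,B,B,W)`

Topic `Literature/Probability/Percolation`; family `crit-perc`. Toward the named fact
`Literature.Probability.Percolation.Nolin2008_thm24_fiveArm_upper` (`FiveArmExponentFacts.lean`):
Nolin's colour switching (EJP 13 (2008), §5.1 Prop. 20 [arXiv 0711.4948: Prop. 19, p. 15]) for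
FIVE arms, from the colour count `(1, 4)` to the colour count `(3, 2)` (equivalently `(2, 3)` at
`p = 1/2`), in the landed form consumed by the five-arm upper bound (`hsw` of
`Nolin2008_thm24_fiveArm_upper_of_landedExt`):

> "we are allowed to condition on the black arm arriving on `I₁` and on the white arm arriving on
> `I₂` that are closest to each other … these two arms can be determined via an exploration
> process starting at `(N,0)`. We can then 'flip' the remaining region. More generally, we can
> condition on any set of consecutive arms including these two arms."

Here three consecutive arms `W(4), B(0), W(1)` (sides `4, 0, 1`) are conditioned on, by TWO runs
of the exploration machine of `FlipFourArm.lean`: in the frame `ρ` (rotation by `60°`; the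
interface between `B(0)` and `W(1)` explored from the corner between the sides `0` and `1`, the
cycle of `FiveArmFlip.exists_flipCycle₂`) and in the frame `ρ³ ∘ (colour exchange)` (the interface
between `W(4)` and `B(0)` explored from the corner between the sides `4` and `5`, the cycle of
`FourArmFlip.exists_flipCycle`). The union of the two examined sets is a stopping set; flipping
the rest of the annulus turns the white arms of sides `2, 3` black and keeps three examined chains
— black near side `0`, white from side `1`, white from side `4` — so that the flipped
configuration has five disjoint arms of colours `B, W, B, B, W`.

* `exists_flipCycle₂` — the cycle "black ring stretch down side `1` + black arm backwards + hole +
  white arm of side `2` + white ring stretch along side `2` back to `(0, N+1)`" with the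
  properties consumed by the winding-number lemmas of `FlipFourArm.lean`
  (`exists_touch`, `not_mem_examined_of_pathIn_far`, `mem_cycle_of_ring_vertex`);
* `not_mem_examined_of_escape` — Claim 9 of Bollobás–Riordan abstractly: an arm of the annulus off
  the cycle whose tip has two outward ring neighbours off the cycle is not examined; instances for
  arms landed on sides `3, 4, 5` (cycle of `exists_flipCycle₂`) and on sides `4, 5` (cycle of
  `FourArmFlip.exists_flipCycle`, any colour);
* `explore_black_chain`, `explore_white_chain₂` — the examined black chain from side `1` to `∂Λ_n`
  and (for the adjacent cycle) the examined white chain from side `2` to `∂Λ_n`, as sets of sites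
  carrying `𝕋`-paths (Bollobás–Riordan, Claim 8).

* `landedOneFour n N` — the input: five pairwise disjoint arms of the annulus `{n ≤ |·| ≤ N}`,
  black landed strictly inside side `0`, white landed strictly inside sides `1, 2, 3, 4`;
* `frameA`, `frameB`, `examinedA`, `examinedB`, `examinedAB`, `isStoppingSet_examinedAB`,
  `fiveArmFlip`, `real_preimage_fiveArmFlip` — the two frames, the union stopping set, the flip and
  its measure preservation (`ColourSwitching.lean`);
* `frameA_pack`, `frameB_pack`, `fiveArmFlip_mem_armEvent` — **the flip maps `landedOneFour n N`
  into `armEvent (B,W,B,B,W) n N`**;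
* `sepOpenArmIn_landed`, `sepArms_subset_landedOneFour` — the well-separated five-arm event
  `sepArms (B,W,W,W,W) m N` of `SepArmsGlue.lean` (the target of Nolin's arm separation, Thm. 11)
  is contained in `landedOneFour m N` (`4 ≤ m`, `2m ≤ N`);
* `real_landedOneFour_le_polyArmProb`, `real_sepArms_oneFour_le_polyArmProb` —
  `P_{1/2}(landedOneFour m N) ≤ π_{(B,W,B,B,W)}(m, N)` and
  **`P_{1/2}(sepArms (B,W,W,W,W) m N) ≤ π_{(B,W,B,B,W)}(m, N)`**.

Everything is proved; no named fact is introduced.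

## References

* P. Nolin, Near-critical percolation in two dimensions, *Electron. J. Probab.* 13 (2008)
  1562–1623, §5.1 Prop. 19–20 (arXiv 0711.4948: Prop. 18–19, p. 15) [Nolin2008].
* B. Bollobás, O. Riordan, *Percolation*, Cambridge Univ. Press (2006), Ch. 7 Lemma 6 and
  Claims 7–9, pp. 172–175 [BollobasRiordan2006].
* H. Kesten, V. Sidoravicius, Y. Zhang, Almost all words are seen in critical site percolation on
  the triangular lattice, *Electron. J. Probab.* 3 (1998), proof of Lemma 5, (3.14)–(3.15):
  "`P{G(w,n)} = P{F(w,n)}`" [KestenSidoraviciusZhang1998].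

## Mathlib / tree

Tree: `FlipFourArm.lean` (the machine, `exists_flipCycle`, `not_mem_examined_of_arm0`,
`isStoppingSet_examined`, `examined_subset`, `examined_congr`), `FlipFiveArmCycle.lean`,
`stopFlip`, `IsStoppingSet.sitePercolation_half_real_preimage_stopFlip` (`ColourSwitching.lean`),
`rotConfig`, `mem_rotConfig`, `rot_apply_formula`, `triRotIsoPow_add_apply`, `triNorm_rot`
(`ArmSeparationRotate.lean`), `rot3_rot3`, `rot1_rot5`, `rot5_rot1` (`ArmSeparationUntwistFour.lean`,
`ArmSeparationHalfStepFour.lean`), `triNorm_lt_of_mem_sepInnerFence` (`SepFourAdj.lean`), `mem_armEvent_of_disjointPaths`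
(`ArmSeparationFourArm.lean`), `determinedBy_armEvent` (`ArmEventsStructure.lean`),
`pathIn_map_iso`, `PathIn.exists_support`, `PathIn.exists_walk`, `PathIn.last_exit`, `PathIn.exit`
(`SitePaths.lean`), `sepArms`, `sepArmAt`, `sepOpenArmIn`, `readFrame` (`SepArmsGlue.lean`,
`ArmSeparationFourArm.lean`).
-/

noncomputable section

open Set MeasureTheory

namespace Literature.Probability.Percolation

open LatticeModels

namespace FiveArmFlip

open FourArmFlip
open Literature.Combinatorics.Enumerative

variable {n N : ℕ}

/-! ### Ring stretches -/

/-- The `i`-th site `(i + 1, N - i)` of the black stretch of the outer ring down side `1` (from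
`(1, N)`; the private `fA` of `FlipFourArm.lean`). [folklore] -/
def rA (N : ℕ) (i : ℕ) : Site 2 := ![(i : ℤ) + 1, (N : ℤ) - i]

/-- The `i`-th site `(-K + i, N + 1)` of the white stretch of the outer ring along side `2`, from
the ring neighbour `(-K, N + 1)` of the landing site `(-K, N)` rightwards. [folklore] -/
def rB (N K : ℕ) (i : ℕ) : Site 2 := ![-(K : ℤ) + i, (N : ℤ) + 1]

/-- Norm and colour of the black stretch. [folklore] -/
theorem rA_spec {ω : SiteConfig (Site 2)} {i : ℕ} (hi : i ≤ N) :
    triNorm (rA N i) = N + 1 ∧ rA N i ∈ flipConfig n N ω ∧ (rA N i) 0 = i + 1 ∧ (rA N i) 1 = N - i := by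
  have h := triNorm_eq_of_apply_eq (y := rA N i) (a := i + 1) (b := N - i) (by simp [rA]) (by simp [rA])
  have hn : triNorm (rA N i) = N + 1 := by omega
  refine ⟨hn, Or.inr ⟨hn, by simp [rA]⟩, by simp [rA], by simp [rA]⟩

/-- Norm and colour of the white stretch along side `2`. [folklore] -/
theorem rB_spec {ω : SiteConfig (Site 2)} {K i : ℕ} (hi : i + 1 ≤ K) (hK : K ≤ N) :
    triNorm (rB N K i) = N + 1 ∧ rB N K i ∉ flipConfig n N ω ∧ (rB N K i) 0 = -(K : ℤ) + i ∧ (rB N K i) 1 = N + 1 := by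
  have h := triNorm_eq_of_apply_eq (y := rB N K i) (a := -(K : ℤ) + i) (b := N + 1) (by simp [rB]) (by simp [rB])
  have hn : triNorm (rB N K i) = N + 1 := by omega
  refine ⟨hn, ?_, by simp [rB], by simp [rB]⟩
  rintro (h' | h')
  · omega
  · have : (rB N K i) 0 = -(K : ℤ) + i := by simp [rB]
    omega

/-- `rA N 0 = (1, N)` is the black vertex of the junction face. [folklore] -/
theorem rA_zero_eq (N : ℕ) : rA N 0 = faceVertex (startFace N) 1 := by
  ext i; fin_cases i <;> simp [rA, faceVertex_startFace]

variable (n N) in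
/-- The relation carried by consecutive vertices of the cycle: adjacency, and the pieces
property (junction side, or equal explored colours, or an endpoint in the hole). [folklore] -/
abbrev CRel₂ (ω : SiteConfig (Site 2)) (u v : Site 2) : Prop :=
  triGraph.Adj u v ∧ ((u = faceVertex (startFace N) 2 ∧ v = faceVertex (startFace N) 1) ∨
    (u ∈ flipConfig n N ω ↔ v ∈ flipConfig n N ω) ∨ triNorm u < n ∨ triNorm v < n)

set_option maxHeartbeats 1000000 in
/-- **The cycle for a black arm on side `1` and a white arm on the adjacent side `2`.** Given a
black arm `p₁` from a site `a₁` of norm `n` to a site `y₁` of side `1` of `∂Λ_N` and a white arm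
`p₂` from `a₂` (norm `n`) to a site `y₂ = (y₂₀, N)` of side `2` off its right corner (`y₂₀ < 0`),
both inside the annulus, there is a closed lattice polyline through `v₀ = (0, N+1)` — the black
ring stretch `(1,N), …` down side `1` to the ring neighbour of `y₁`, `p₁` backwards, a path
through the hole from `a₁` to `a₂`, `p₂`, the white ring stretch from the ring neighbour
`(y₂₀, N+1)` of `y₂` along side `2` back to `v₀` — with the properties of
`FourArmFlip.exists_flipCycle`: unit pieces, monochromatic for the explored colouring except the
junction side (the first piece, occurring once) and the hole edges, vertices of norm `≤ N + 1`,
and an explicit description of its vertices (Bollobás–Riordan 2006, proof of Claim 7, the cycle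
`C`; Nolin 2008, proof of Prop. 20, two CONSECUTIVE arms). [cite: BollobasRiordan2006, Ch. 7 Claim 7 p. 173] [cite: Nolin2008, §5.1 Prop. 20 (arXiv 0711.4948: Prop. 19)] -/
theorem exists_flipCycle₂ (hn : 1 ≤ n) (hnN : n ≤ N) {ω : SiteConfig (Site 2)} {a₁ y₁ a₂ y₂ : Site 2}
    (p₁ : triGraph.Walk a₁ y₁) (p₂ : triGraph.Walk a₂ y₂) (ha₁ : triNorm a₁ = n) (ha₂ : triNorm a₂ = n)
    (hy₁ : y₁ 0 + y₁ 1 = N) (hy₁N : triNorm y₁ = N) (hy₂ : y₂ 1 = N) (hy₂N : triNorm y₂ = N) (hy₂0 : y₂ 0 < 0)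
    (hp₁ : ∀ z ∈ p₁.support, (n : ℤ) ≤ triNorm z ∧ triNorm z ≤ N ∧ z ∈ ω)
    (hp₂ : ∀ z ∈ p₂.support, (n : ℤ) ≤ triNorm z ∧ triNorm z ≤ N ∧ z ∉ ω) :
    ∃ l : List (Site 2),
      (∀ v ∈ faceVertex (startFace N) 2 :: l, triNorm v ≤ N + 1) ∧
      (∀ p ∈ latPieces (faceVertex (startFace N) 2) l, p.1 = p.2 ∨ triGraph.Adj p.1 p.2) ∧
      (∀ p ∈ latPieces (faceVertex (startFace N) 2) l,
        (p.1 = faceVertex (startFace N) 2 ∧ p.2 = faceVertex (startFace N) 1) ∨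
          (p.1 ∈ flipConfig n N ω ↔ p.2 ∈ flipConfig n N ω) ∨ triNorm p.1 < n ∨ triNorm p.2 < n) ∧
      (∃ L₂ : List (Site 2 × Site 2),
        latPieces (faceVertex (startFace N) 2) l = (faceVertex (startFace N) 2, faceVertex (startFace N) 1) :: L₂ ∧
        ∀ p ∈ L₂, ¬ ((p.1 = faceVertex (startFace N) 1 ∧ p.2 = faceVertex (startFace N) 2) ∨
          (p.1 = faceVertex (startFace N) 2 ∧ p.2 = faceVertex (startFace N) 1))) ∧
      (∀ z ∈ l, z ∈ p₁.support ∨ z ∈ p₂.support ∨ triNorm z < n ∨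
        (triNorm z = N + 1 ∧ ((z 1 = N + 1 ∧ -(N : ℤ) ≤ z 0 ∧ z 0 ≤ -1) ∨
          (1 ≤ z 0 ∧ z 0 ≤ y₁ 0 + 1 ∧ z 0 + z 1 = N + 1)))) := by
  -- coordinates of the tips
  obtain ⟨hK0, hKN⟩ := side1_bounds hy₁ hy₁N
  have hy₂b : -(N : ℤ) ≤ y₂ 0 := by
    have h := triNorm_eq_of_apply_eq (y := y₂) rfl rfl
    omega
  have hN1 : 1 ≤ N := hn.trans hnN
  obtain ⟨K, hK⟩ : ∃ K : ℕ, (K : ℤ) = y₁ 0 := ⟨(y₁ 0).toNat, Int.toNat_of_nonneg hK0⟩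
  obtain ⟨K₂, hK₂⟩ : ∃ K₂ : ℕ, (K₂ : ℤ) = -y₂ 0 := ⟨(-y₂ 0).toNat, Int.toNat_of_nonneg (by omega)⟩
  obtain ⟨m₂, hm₂'⟩ : ∃ m : ℕ, (m : ℤ) = -y₂ 0 - 1 := ⟨(-y₂ 0 - 1).toNat, Int.toNat_of_nonneg (by omega)⟩
  -- the hole
  obtain ⟨d₁, had₁, hd₁, -⟩ := exists_adj_triNorm_lt hn ha₁
  obtain ⟨d₂, had₂, hd₂, -⟩ := exists_adj_triNorm_lt hn ha₂
  obtain ⟨H, hH⟩ := exists_walk_hole hd₁ hd₂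
  -- the blocks
  have hv₀c : faceVertex (startFace N) 2 = ![0, (N : ℤ) + 1] := faceVertex_startFace N 2
  have hbsc : faceVertex (startFace N) 1 = ![1, (N : ℤ)] := faceVertex_startFace N 1
  set v₀ := faceVertex (startFace N) 2 with hv₀
  set ringA := (List.range (K + 1)).map (rA N) with hringA
  set ringB := (List.range (m₂ + 1)).map (rB N K₂) with hringB
  set l := ringA ++ (p₁.reverse.support ++ (H.support ++ (p₂.support ++ ringB))) with hl
  -- colours of the arm sites
  have hc₁ : ∀ z ∈ p₁.reverse.support, z ∈ flipConfig n N ω := by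
    intro z hz
    rw [SimpleGraph.Walk.support_reverse, List.mem_reverse] at hz
    obtain ⟨h1, h2, h3⟩ := hp₁ z hz
    exact Or.inl ⟨h3, h1, h2⟩
  have hc₂ : ∀ z ∈ p₂.support, z ∉ flipConfig n N ω := by
    intro z hz h
    obtain ⟨h1, h2, h3⟩ := hp₂ z hz
    rcases h with h | h
    · exact h3 h.1
    · omega
  have hv₀n : v₀ ∉ flipConfig n N ω := faceVertex_startFace_two_not_mem ω
  -- chains of the blocks
  have hv₀0 : v₀ 0 = 0 := by rw [hv₀c]; simp
  have hv₀1 : v₀ 1 = N + 1 := by rw [hv₀c]; simp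
  have hy₁1 : y₁ 1 = N - K := by omega
  have hKN' : K ≤ N := by omega
  have hK₂N : K₂ ≤ N := by omega
  have hK₂1 : 1 ≤ K₂ := by omega
  have hm₂K : m₂ + 1 = K₂ := by omega
  have cA : List.IsChain (CRel₂ n N ω) ringA := by
    refine isChain_map_range_succ _ fun i hi => ?_
    obtain ⟨-, hc, h0, h1⟩ := rA_spec (n := n) (N := N) (ω := ω) (i := i) (by omega)
    obtain ⟨-, hc', h0', h1'⟩ := rA_spec (n := n) (N := N) (ω := ω) (i := i + 1) (by omega)
    refine ⟨(triGraph_adj_iff_coord _ _).2 ?_, Or.inr (Or.inl (iff_of_true hc hc'))⟩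
    rw [h0, h1, h0', h1']; push_cast; omega
  have cB : List.IsChain (CRel₂ n N ω) ringB := by
    refine isChain_map_range_succ _ fun i hi => ?_
    obtain ⟨-, hc, h0, h1⟩ := rB_spec (n := n) (N := N) (ω := ω) (K := K₂) (i := i) (by omega) hK₂N
    obtain ⟨-, hc', h0', h1'⟩ := rB_spec (n := n) (N := N) (ω := ω) (K := K₂) (i := i + 1) (by omega) hK₂N
    refine ⟨(triGraph_adj_iff_coord _ _).2 ?_, Or.inr (Or.inl (iff_of_false hc hc'))⟩
    rw [h0, h1, h0', h1']; push_cast; omega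
  -- specs of the block ends
  obtain ⟨-, hcA0, hA00, hA01⟩ := rA_spec (n := n) (N := N) (ω := ω) (i := 0) (Nat.zero_le _)
  obtain ⟨-, hcAK, hAK0, hAK1⟩ := rA_spec (n := n) (N := N) (ω := ω) (i := K) hKN'
  obtain ⟨-, hcB0, hB00, hB01⟩ := rB_spec (n := n) (N := N) (ω := ω) (K := K₂) (i := 0) (by omega) hK₂N
  obtain ⟨-, hcBm, hBm0, hBm1⟩ := rB_spec (n := n) (N := N) (ω := ω) (K := K₂) (i := m₂) (by omega) hK₂N
  have hringB_head : ringB.head? = some (rB N K₂ 0) := by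
    rw [hringB, head?_map_range_succ]
  have hringB_last : ringB.getLast? = some (rB N K₂ m₂) := by
    rw [hringB, getLast?_map_range_succ]
  have c6 : List.IsChain (CRel₂ n N ω) (ringB ++ [v₀]) := by
    refine cB.append (List.isChain_singleton _) fun x hx y hy => ?_
    rw [hringB_last] at hx
    simp only [Option.mem_def, Option.some.injEq, List.head?_cons] at hx hy
    subst hx hy
    refine ⟨(triGraph_adj_iff_coord _ _).2 ?_, Or.inr (Or.inl (iff_of_false hcBm hv₀n))⟩
    rw [hBm0, hBm1, hv₀0, hv₀1]; push_cast; omega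
  have c5 : List.IsChain (CRel₂ n N ω) (p₂.support ++ (ringB ++ [v₀])) := by
    refine (isChain_support_of (Q := fun z => z ∉ flipConfig n N ω) p₂ hc₂
      fun a b hab ha hb => ⟨hab, Or.inr (Or.inl (iff_of_false ha hb))⟩).append c6 fun x hx y hy => ?_
    rw [getLast?_support] at hx
    rw [List.head?_append, hringB_head, Option.some_or] at hy
    simp only [Option.mem_def, Option.some.injEq] at hx hy
    subst hx hy
    refine ⟨(triGraph_adj_iff_coord _ _).2 ?_, Or.inr (Or.inl (iff_of_false (hc₂ _ p₂.end_mem_support) hcB0))⟩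
    rw [hB00, hB01, hy₂, hK₂]; omega
  have c4 : List.IsChain (CRel₂ n N ω) (H.support ++ (p₂.support ++ (ringB ++ [v₀]))) := by
    refine (isChain_support_of (Q := fun z => triNorm z < n) H hH
      fun a b hab ha _ => ⟨hab, Or.inr (Or.inr (Or.inl ha))⟩).append c5 fun x hx y hy => ?_
    rw [getLast?_support] at hx
    rw [List.head?_append, head?_support, Option.some_or] at hy
    simp only [Option.mem_def, Option.some.injEq] at hx hy
    subst hx hy
    exact ⟨had₂.symm, Or.inr (Or.inr (Or.inl hd₂))⟩
  have c3 : List.IsChain (CRel₂ n N ω) (p₁.reverse.support ++ (H.support ++ (p₂.support ++ (ringB ++ [v₀])))) := by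
    refine (isChain_support_of (Q := fun z => z ∈ flipConfig n N ω) p₁.reverse hc₁
      fun a b hab ha hb => ⟨hab, Or.inr (Or.inl (iff_of_true ha hb))⟩).append c4 fun x hx y hy => ?_
    rw [getLast?_support] at hx
    rw [List.head?_append, head?_support, Option.some_or] at hy
    simp only [Option.mem_def, Option.some.injEq] at hx hy
    subst hx hy
    exact ⟨had₁, Or.inr (Or.inr (Or.inr hd₁))⟩
  have c2 : List.IsChain (CRel₂ n N ω) (ringA ++ (p₁.reverse.support ++ (H.support ++ (p₂.support ++ (ringB ++ [v₀]))))) := by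
    refine cA.append c3 fun x hx y hy => ?_
    rw [hringA, getLast?_map_range_succ] at hx
    rw [List.head?_append, head?_support, Option.some_or] at hy
    simp only [Option.mem_def, Option.some.injEq] at hx hy
    subst hx hy
    refine ⟨(triGraph_adj_iff_coord _ _).2 ?_, Or.inr (Or.inl (iff_of_true hcAK (hc₁ _ p₁.reverse.start_mem_support)))⟩
    rw [hAK0, hAK1, ← hK, hy₁1]; omega
  have hLfull : v₀ :: l ++ [v₀] = v₀ :: (ringA ++ (p₁.reverse.support ++ (H.support ++ (p₂.support ++ (ringB ++ [v₀]))))) := by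
    simp only [hl, List.cons_append, List.append_assoc]
  have hringA_head : ringA.head? = some (rA N 0) := by rw [hringA, head?_map_range_succ]
  have hchain : List.IsChain (CRel₂ n N ω) (v₀ :: l ++ [v₀]) := by
    rw [hLfull]
    refine c2.cons fun y hy => ?_
    rw [List.head?_append, hringA_head, Option.some_or] at hy
    simp only [Option.mem_def, Option.some.injEq] at hy
    subst hy
    refine ⟨(triGraph_adj_iff_coord _ _).2 (Or.inr (Or.inr (Or.inr (Or.inr (Or.inl ⟨?_, ?_⟩))))), Or.inl ⟨rfl, rA_zero_eq N⟩⟩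
    · rw [hA00, hv₀0]; simp
    · rw [hA01, hv₀1]; simp
  have hpieces : ∀ p ∈ latPieces v₀ l, CRel₂ n N ω p.1 p.2 := fun p hp =>
    isChain_iff_forall_consecPairs.1 hchain p (by rwa [latPieces_eq_consecPairs] at hp)
  -- the colour facts unfold to disjunctions; remove them before the arithmetic below
  clear hcA0 hcAK hcB0 hcBm hv₀n hc₁ hc₂ cA cB c6 c5 c4 c3 c2 hchain
  -- membership in the cycle
  have hmem : ∀ z ∈ l, z ∈ p₁.support ∨ z ∈ p₂.support ∨ triNorm z < n ∨
      (triNorm z = N + 1 ∧ ((z 1 = N + 1 ∧ -(N : ℤ) ≤ z 0 ∧ z 0 ≤ -1) ∨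
        (1 ≤ z 0 ∧ z 0 ≤ y₁ 0 + 1 ∧ z 0 + z 1 = N + 1))) := by
    intro z hz
    rw [hl] at hz
    rcases List.mem_append.1 hz with hz | hz
    · rw [hringA] at hz
      obtain ⟨i, hi, rfl⟩ := (mem_map_range_iff _ _ _).1 hz
      have hiN : i ≤ N := (Nat.lt_succ_iff.1 hi).trans hKN'
      obtain ⟨h1, -, h3, h4⟩ := rA_spec (n := n) (N := N) (ω := ω) (i := i) hiN
      refine Or.inr (Or.inr (Or.inr ⟨h1, Or.inr ⟨?_, ?_, ?_⟩⟩))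
      · rw [h3]; have := Int.natCast_nonneg i; linarith
      · rw [h3, ← hK]; exact_mod_cast (Nat.succ_le_succ (Nat.lt_succ_iff.1 hi) : i + 1 ≤ K + 1)
      · rw [h3, h4]; ring
    rcases List.mem_append.1 hz with hz | hz
    · rw [SimpleGraph.Walk.support_reverse, List.mem_reverse] at hz
      exact Or.inl hz
    rcases List.mem_append.1 hz with hz | hz
    · exact Or.inr (Or.inr (Or.inl (hH z hz)))
    rcases List.mem_append.1 hz with hz | hz
    · exact Or.inr (Or.inl hz)
    rw [hringB] at hz
    obtain ⟨i, hi, rfl⟩ := (mem_map_range_iff _ _ _).1 hz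
    obtain ⟨h1, -, h3, h4⟩ := rB_spec (n := n) (N := N) (ω := ω) (K := K₂) (i := i)
      (by clear * - hi hm₂K; omega) hK₂N
    refine Or.inr (Or.inr (Or.inr ⟨h1, Or.inl ⟨h4, ?_, ?_⟩⟩))
    · rw [h3]
      have h0i := Int.natCast_nonneg i
      have hKN2 : (K₂ : ℤ) ≤ N := by exact_mod_cast hK₂N
      clear * - h0i hKN2; omega
    · rw [h3]; clear * - hi hm₂K; omega
  have hv₀N : triNorm v₀ = N + 1 := triNorm_startFace_two N
  have hv₀l : v₀ ∉ l := by
    intro h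
    rcases hmem v₀ h with h | h | h | ⟨-, ⟨-, -, h⟩ | ⟨h, -⟩⟩
    · have := (hp₁ _ h).2.1; clear * - this hv₀N hnN; omega
    · have := (hp₂ _ h).2.1; clear * - this hv₀N hnN; omega
    · clear * - h hv₀N hnN; omega
    · rw [hv₀0] at h; clear * - h; omega
    · rw [hv₀0] at h; clear * - h; omega
  refine ⟨l, ?_, fun p hp => Or.inr (hpieces p hp).1, fun p hp => (hpieces p hp).2, ?_, hmem⟩
  · -- norms
    intro z hz
    rcases List.mem_cons.1 hz with rfl | hz
    · exact hv₀N.le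
    rcases hmem z hz with h | h | h | ⟨h, -⟩
    · have := (hp₁ _ h).2.1; clear * - this; omega
    · have := (hp₂ _ h).2.1; clear * - this; omega
    · clear * - h hnN; omega
    · exact h.le
  · -- the junction side is the first piece and occurs once
    refine ⟨consecPairs (l ++ [v₀]), ?_, ?_⟩
    · have hl' : l = rA N 0 :: (((List.range K).map (rA N ∘ Nat.succ)) ++ (p₁.reverse.support ++ (H.support ++ (p₂.support ++ ringB)))) := by
        rw [hl, hringA, List.range_succ_eq_map, List.map_cons, List.map_map, List.cons_append]
      rw [latPieces_eq_consecPairs]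
      conv_lhs => rw [hl']
      rw [List.cons_append, List.cons_append, consecPairs_cons_cons, ← List.cons_append, ← hl', rA_zero_eq]
    · intro p hp
      obtain ⟨i, hi, h1, h2⟩ := mem_consecPairs_iff.1 hp
      rw [List.length_append, List.length_singleton] at hi
      have hp1 : p.1 ∈ l := by
        rw [← h1, List.getElem_append_left (by clear * - hi; omega)]
        exact List.getElem_mem _
      have hp1v : p.1 ≠ v₀ := fun h => hv₀l (h ▸ hp1)
      rintro (⟨hq1, hq2⟩ | ⟨hq1, -⟩)
      · -- `p = (bs, v₀)`: then `p.1` is the last vertex `(-1, N+1)` of `l`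
        by_cases hil : i + 1 < l.length
        · have hp2 : p.2 ∈ l := by
            rw [← h2, List.getElem_append_left hil]
            exact List.getElem_mem _
          exact hv₀l (hq2 ▸ hp2)
        · have hil' : i = l.length - 1 := by clear * - hi hil; omega
          have hne : l ≠ [] := by rw [hl, hringA]; simp
          have hlast : l.getLast hne = rB N K₂ m₂ := by
            have h' : l.getLast? = some (rB N K₂ m₂) := by
              rw [hl, List.getLast?_append_of_ne_nil, List.getLast?_append_of_ne_nil, List.getLast?_append_of_ne_nil,
                List.getLast?_append_of_ne_nil, hringB_last]
              all_goals simp [hringB]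
            rw [List.getLast?_eq_getLast_of_ne_nil hne] at h'
            exact Option.some_injective _ h'
          have hp1' : p.1 = rB N K₂ m₂ := by
            rw [← h1, List.getElem_append_left (by clear * - hi hil; omega), ← hlast, List.getLast_eq_getElem]
            congr 1
          have := congrFun (hp1'.symm.trans hq1) 0
          rw [hbsc, hBm0] at this
          simp at this
          clear * - this hm₂' hK₂ hy₂0
          omega
      · exact hp1v hq1

/-! ### Arms off the cycle are not examined (Claim 9) -/

/-- **Claim 9 of Bollobás–Riordan, abstractly.** For a cycle as in `exists_flipCycle₂` /
`FourArmFlip.exists_flipCycle`: a set of sites `A` off the cycle, each joined inside `A` to a site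
`y` which has a neighbour `e₁` off the cycle adjacent to a site `e₂` of norm `N + 2`, avoids the
examined set — its sites are joined off the cycle to far away, where the winding number is `0`,
not that of the explored faces (`not_mem_examined_of_pathIn_far`). [cite: BollobasRiordan2006, Ch. 7 Claim 9 p. 175] -/
theorem not_mem_examined_of_escape {ω : SiteConfig (Site 2)} {l : List (Site 2)} {L₂ : List (Site 2 × Site 2)}
    (hM : ∀ v ∈ faceVertex (startFace N) 2 :: l, triNorm v ≤ N + 1)
    (hadj : ∀ p ∈ latPieces (faceVertex (startFace N) 2) l, p.1 = p.2 ∨ triGraph.Adj p.1 p.2)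
    (hP : ∀ p ∈ latPieces (faceVertex (startFace N) 2) l,
      (p.1 = faceVertex (startFace N) 2 ∧ p.2 = faceVertex (startFace N) 1) ∨
        (p.1 ∈ flipConfig n N ω ↔ p.2 ∈ flipConfig n N ω) ∨ triNorm p.1 < n ∨ triNorm p.2 < n)
    (hL : latPieces (faceVertex (startFace N) 2) l = (faceVertex (startFace N) 2, faceVertex (startFace N) 1) :: L₂)
    (hL₂ : ∀ p ∈ L₂, ¬ ((p.1 = faceVertex (startFace N) 1 ∧ p.2 = faceVertex (startFace N) 2) ∨
      (p.1 = faceVertex (startFace N) 2 ∧ p.2 = faceVertex (startFace N) 1)))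
    {A : Set (Site 2)} {y : Site 2} (hAS : ∀ v ∈ A, v ∉ faceVertex (startFace N) 2 :: l)
    (hAy : ∀ z ∈ A, PathIn triGraph A z y)
    {e₁ e₂ : Site 2} (he₁ : e₁ ∉ faceVertex (startFace N) 2 :: l) (he₂ : triNorm e₂ = N + 2)
    (hadj₁ : triGraph.Adj y e₁) (hadj₂ : triGraph.Adj e₁ e₂) :
    ∀ z ∈ A, z ∉ examined n N ω := by
  intro z hz
  set S : Set (Site 2) := {u | u ∉ faceVertex (startFace N) 2 :: l} with hS
  have he₂S : e₂ ∈ S := fun hvl => absurd (hM e₂ hvl) (by omega)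
  have hy : y ∈ A := (hAy z hz).right_mem
  refine not_mem_examined_of_pathIn_far hM hadj hP hL hL₂ (S := S) (fun u hu => off_pieces_of_not_mem hu)
    (fun u hu hul => absurd (hM u hul) (by omega)) (u := z) (w := e₂) ?_ (by omega)
  exact ((hAy z hz).mono fun v hv => hAS v hv).trans
    ((PathIn.of_adj (hAS y hy) he₁ hadj₁).trans (PathIn.of_adj he₁ he₂S hadj₂))

section OffCycle

variable {ω : SiteConfig (Site 2)} {l : List (Site 2)} {P₁ P₂ : Set (Site 2)} {y₁ : Site 2}

/-- **Sites of the annulus off the two arms are off the cycle** of `exists_flipCycle₂` (its other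
vertices are hole sites and ring sites). [folklore] -/
theorem not_mem_cycle₂_of_ann
    (hmemC : ∀ z ∈ l, z ∈ P₁ ∨ z ∈ P₂ ∨ triNorm z < n ∨
      (triNorm z = N + 1 ∧ ((z 1 = N + 1 ∧ -(N : ℤ) ≤ z 0 ∧ z 0 ≤ -1) ∨
        (1 ≤ z 0 ∧ z 0 ≤ y₁ 0 + 1 ∧ z 0 + z 1 = N + 1))))
    {v : Site 2} (hv1 : (n : ℤ) ≤ triNorm v) (hv2 : triNorm v ≤ N) (hv₁ : v ∉ P₁) (hv₂ : v ∉ P₂) :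
    v ∉ faceVertex (startFace N) 2 :: l := by
  intro hvl
  have hv₀N : triNorm (faceVertex (startFace N) 2) = N + 1 := triNorm_startFace_two N
  rcases List.mem_cons.1 hvl with rfl | hvl
  · omega
  rcases hmemC v hvl with h | h | h | ⟨h, -⟩
  · exact hv₁ h
  · exact hv₂ h
  · omega
  · omega

/-- **Ring sites off the two stretches are off the cycle** of `exists_flipCycle₂`. [folklore] -/
theorem not_mem_cycle₂_of_ring (hnN : n ≤ N)
    (hP₁ : ∀ z ∈ P₁, triNorm z ≤ N) (hP₂ : ∀ z ∈ P₂, triNorm z ≤ N)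
    (hmemC : ∀ z ∈ l, z ∈ P₁ ∨ z ∈ P₂ ∨ triNorm z < n ∨
      (triNorm z = N + 1 ∧ ((z 1 = N + 1 ∧ -(N : ℤ) ≤ z 0 ∧ z 0 ≤ -1) ∨
        (1 ≤ z 0 ∧ z 0 ≤ y₁ 0 + 1 ∧ z 0 + z 1 = N + 1))))
    {v : Site 2} (hvN : triNorm v = N + 1) (hvB : v 1 ≠ N + 1) (hvA : ¬ (1 ≤ v 0 ∧ v 0 + v 1 = N + 1)) :
    v ∉ faceVertex (startFace N) 2 :: l := by
  intro hvl
  rcases List.mem_cons.1 hvl with h | hvl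
  · have := congrFun h 1
    rw [faceVertex_startFace] at this
    simp at this
    exact hvB this
  rcases hmemC v hvl with h | h | h | ⟨-, ⟨h, -⟩ | ⟨h1, -, h3⟩⟩
  · have := hP₁ v h; omega
  · have := hP₂ v h; omega
  · omega
  · exact hvB h
  · exact hvA ⟨h1, h3⟩

/-- **Sites of the annulus off the two arms are off the cycle** of `FourArmFlip.exists_flipCycle`. [folklore] -/
theorem not_mem_cycle₃_of_ann {y₃ : Site 2}
    (hmemC : ∀ z ∈ l, z ∈ P₁ ∨ z ∈ P₂ ∨ triNorm z < n ∨
      (triNorm z = N + 1 ∧ ((z 0 = -(N : ℤ) - 1 ∧ y₃ 1 ≤ z 1) ∨ (z 1 = N + 1 ∧ -(N : ℤ) ≤ z 0 ∧ z 0 ≤ -1) ∨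
        (1 ≤ z 0 ∧ z 0 ≤ y₁ 0 + 1 ∧ z 0 + z 1 = N + 1))))
    {v : Site 2} (hv1 : (n : ℤ) ≤ triNorm v) (hv2 : triNorm v ≤ N) (hv₁ : v ∉ P₁) (hv₂ : v ∉ P₂) :
    v ∉ faceVertex (startFace N) 2 :: l := by
  intro hvl
  have hv₀N : triNorm (faceVertex (startFace N) 2) = N + 1 := triNorm_startFace_two N
  rcases List.mem_cons.1 hvl with rfl | hvl
  · omega
  rcases hmemC v hvl with h | h | h | ⟨h, -⟩
  · exact hv₁ h
  · exact hv₂ h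
  · omega
  · omega

/-- **Ring sites off the three stretches are off the cycle** of `FourArmFlip.exists_flipCycle`. [folklore] -/
theorem not_mem_cycle₃_of_ring {y₃ : Site 2} (hnN : n ≤ N)
    (hP₁ : ∀ z ∈ P₁, triNorm z ≤ N) (hP₂ : ∀ z ∈ P₂, triNorm z ≤ N)
    (hmemC : ∀ z ∈ l, z ∈ P₁ ∨ z ∈ P₂ ∨ triNorm z < n ∨
      (triNorm z = N + 1 ∧ ((z 0 = -(N : ℤ) - 1 ∧ y₃ 1 ≤ z 1) ∨ (z 1 = N + 1 ∧ -(N : ℤ) ≤ z 0 ∧ z 0 ≤ -1) ∨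
        (1 ≤ z 0 ∧ z 0 ≤ y₁ 0 + 1 ∧ z 0 + z 1 = N + 1))))
    {v : Site 2} (hvN : triNorm v = N + 1) (hvC : v 0 ≠ -(N : ℤ) - 1) (hvB : v 1 ≠ N + 1)
    (hvA : ¬ (1 ≤ v 0 ∧ v 0 + v 1 = N + 1)) :
    v ∉ faceVertex (startFace N) 2 :: l := by
  intro hvl
  rcases List.mem_cons.1 hvl with h | hvl
  · have := congrFun h 1
    rw [faceVertex_startFace] at this
    simp at this
    exact hvB this
  rcases hmemC v hvl with h | h | h | ⟨-, ⟨h, -⟩ | ⟨h, -⟩ | ⟨h1, -, h3⟩⟩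
  · have := hP₁ v h; omega
  · have := hP₂ v h; omega
  · omega
  · exact hvC h
  · exact hvB h
  · exact hvA ⟨h1, h3⟩

end OffCycle

/-- Norms of the two outward escape sites beyond a tip on side `3` (`x₀ = -N`, `0 ≤ x₁ ≤ N`):
`(-N-1, x₁)`, `(-N-2, x₁)`. [folklore] -/
theorem escape_side3 {y : Site 2} (hy : y 0 = -(N : ℤ)) (hy1 : 0 ≤ y 1) (hy1' : y 1 ≤ N) :
    triNorm (![-(N : ℤ) - 1, y 1] : Site 2) = N + 1 ∧ triNorm (![-(N : ℤ) - 2, y 1] : Site 2) = N + 2 ∧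
      triGraph.Adj y ![-(N : ℤ) - 1, y 1] ∧ triGraph.Adj (![-(N : ℤ) - 1, y 1] : Site 2) ![-(N : ℤ) - 2, y 1] := by
  have h1 := triNorm_eq_of_apply_eq (y := (![-(N : ℤ) - 1, y 1] : Site 2)) (a := -(N : ℤ) - 1) (b := y 1) (by simp) (by simp)
  have h2 := triNorm_eq_of_apply_eq (y := (![-(N : ℤ) - 2, y 1] : Site 2)) (a := -(N : ℤ) - 2) (b := y 1) (by simp) (by simp)
  refine ⟨by omega, by omega, (triGraph_adj_iff_coord _ _).2 ?_, (triGraph_adj_iff_coord _ _).2 ?_⟩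
  · simp [hy]
  · simp; ring

/-- Norms of the two outward escape sites beyond a tip on side `4` (`x₀ + x₁ = -N`, `-N ≤ x₀ ≤ 0`):
`y - (0,1)`, `y - (0,2)`. [folklore] -/
theorem escape_side4 {y : Site 2} (hy : y 0 + y 1 = -(N : ℤ)) (hy0 : -(N : ℤ) ≤ y 0) (hy0' : y 0 ≤ 0) :
    triNorm (![y 0, y 1 - 1] : Site 2) = N + 1 ∧ triNorm (![y 0, y 1 - 2] : Site 2) = N + 2 ∧
      triGraph.Adj y ![y 0, y 1 - 1] ∧ triGraph.Adj (![y 0, y 1 - 1] : Site 2) ![y 0, y 1 - 2] := by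
  have h1 := triNorm_eq_of_apply_eq (y := (![y 0, y 1 - 1] : Site 2)) (a := y 0) (b := y 1 - 1) (by simp) (by simp)
  have h2 := triNorm_eq_of_apply_eq (y := (![y 0, y 1 - 2] : Site 2)) (a := y 0) (b := y 1 - 2) (by simp) (by simp)
  refine ⟨by omega, by omega, (triGraph_adj_iff_coord _ _).2 ?_, (triGraph_adj_iff_coord _ _).2 ?_⟩
  · simp
  · simp; ring

/-- Norms of the two outward escape sites beyond a tip on side `5` (`x₁ = -N`, `0 ≤ x₀ ≤ N`):
`(x₀, -N-1)`, `(x₀, -N-2)`. [folklore] -/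
theorem escape_side5 {y : Site 2} (hy : y 1 = -(N : ℤ)) (hy0 : 0 ≤ y 0) (hy0' : y 0 ≤ N) :
    triNorm (![y 0, -(N : ℤ) - 1] : Site 2) = N + 1 ∧ triNorm (![y 0, -(N : ℤ) - 2] : Site 2) = N + 2 ∧
      triGraph.Adj y ![y 0, -(N : ℤ) - 1] ∧ triGraph.Adj (![y 0, -(N : ℤ) - 1] : Site 2) ![y 0, -(N : ℤ) - 2] := by
  have h1 := triNorm_eq_of_apply_eq (y := (![y 0, -(N : ℤ) - 1] : Site 2)) (a := y 0) (b := -(N : ℤ) - 1) (by simp) (by simp)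
  have h2 := triNorm_eq_of_apply_eq (y := (![y 0, -(N : ℤ) - 2] : Site 2)) (a := y 0) (b := -(N : ℤ) - 2) (by simp) (by simp)
  refine ⟨by omega, by omega, (triGraph_adj_iff_coord _ _).2 ?_, (triGraph_adj_iff_coord _ _).2 ?_⟩
  · simp [hy]
  · simp; ring

/-- Norms of the two outward escape sites beyond a tip on side `0` (`x₀ = N`): `y + (1,0)`,
`y + (2,0)`. [folklore] -/
theorem escape_side0 {y : Site 2} (hy : y 0 = N) (hy1 : -(N : ℤ) ≤ y 1) (hy1' : y 1 ≤ 0) :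
    triNorm (![(N : ℤ) + 1, y 1] : Site 2) = N + 1 ∧ triNorm (![(N : ℤ) + 2, y 1] : Site 2) = N + 2 ∧
      triGraph.Adj y ![(N : ℤ) + 1, y 1] ∧ triGraph.Adj (![(N : ℤ) + 1, y 1] : Site 2) ![(N : ℤ) + 2, y 1] := by
  have h1 := triNorm_eq_of_apply_eq (y := (![(N : ℤ) + 1, y 1] : Site 2)) (a := (N : ℤ) + 1) (b := y 1) (by simp) (by simp)
  have h2 := triNorm_eq_of_apply_eq (y := (![(N : ℤ) + 2, y 1] : Site 2)) (a := (N : ℤ) + 2) (b := y 1) (by simp) (by simp)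
  refine ⟨by omega, by omega, (triGraph_adj_iff_coord _ _).2 ?_, (triGraph_adj_iff_coord _ _).2 ?_⟩
  · simp [hy]
  · simp; ring


/-! ### The explored chains -/

set_option maxHeartbeats 4000000 in
/-- **The two chains along the explored interface** (Bollobás–Riordan 2006, Claim 8; Nolin 2008,
proof of Prop. 20: "these two arms can be determined via an exploration process"). For a cycle
with the properties of `exists_flipCycle₂` / `FourArmFlip.exists_flipCycle` whose ring vertices
with `z₀ ≥ 1` lie on the black stretch down side `1` (`hringA`), the exploration of
`FlipFourArm.lean` reaches the hole (`exists_touch`) and the black exit sites of the explored faces,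
from the last one off the annulus on, form a set `S_B` of EXAMINED open sites of the annulus
carrying a `𝕋`-path from a site `t_B` of side `1` of `∂Λ_N` to a site `e_B` of `∂Λ_n`; likewise
the white exit sites form a set `S_W` of examined closed sites carrying a path from a site `t_W`
of `∂Λ_N` to `∂Λ_n`, and `t_W` lies on side `2` as soon as the white ring vertices of the cycle
lie on the ring over side `2` (`hringB`, the cycle of `exists_flipCycle₂`). [cite: BollobasRiordan2006, Ch. 7 Claim 8 p. 175] [cite: Nolin2008, §5.1 Prop. 20 (arXiv 0711.4948: Prop. 19)] -/
theorem explore_chains (hnN : n ≤ N) {ω : SiteConfig (Site 2)} {l : List (Site 2)} {L₂ : List (Site 2 × Site 2)}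
    (hM : ∀ v ∈ faceVertex (startFace N) 2 :: l, triNorm v ≤ N + 1)
    (hadj : ∀ p ∈ latPieces (faceVertex (startFace N) 2) l, p.1 = p.2 ∨ triGraph.Adj p.1 p.2)
    (hP : ∀ p ∈ latPieces (faceVertex (startFace N) 2) l,
      (p.1 = faceVertex (startFace N) 2 ∧ p.2 = faceVertex (startFace N) 1) ∨
        (p.1 ∈ flipConfig n N ω ↔ p.2 ∈ flipConfig n N ω) ∨ triNorm p.1 < n ∨ triNorm p.2 < n)
    (hL : latPieces (faceVertex (startFace N) 2) l = (faceVertex (startFace N) 2, faceVertex (startFace N) 1) :: L₂)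
    (hL₂ : ∀ p ∈ L₂, ¬ ((p.1 = faceVertex (startFace N) 1 ∧ p.2 = faceVertex (startFace N) 2) ∨
      (p.1 = faceVertex (startFace N) 2 ∧ p.2 = faceVertex (startFace N) 1)))
    (hringA : ∀ z ∈ l, triNorm z = N + 1 → 1 ≤ z 0 → z 0 + z 1 = N + 1) :
    ∃ (SB SW : Set (Site 2)) (tB eB tW eW : Site 2),
      SB ⊆ {z | z ∈ examined n N ω ∧ z ∈ ω ∧ (n : ℤ) ≤ triNorm z ∧ triNorm z ≤ N} ∧
      SW ⊆ {z | z ∈ examined n N ω ∧ z ∉ ω ∧ (n : ℤ) ≤ triNorm z ∧ triNorm z ≤ N} ∧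
      triNorm eB = n ∧ triNorm eW = n ∧
      (tB 0 + tB 1 = N ∧ 0 ≤ tB 0 ∧ triNorm tB = N) ∧
      (triNorm tW = N ∧
        ((∀ z ∈ l, triNorm z = N + 1 → z ∉ flipConfig n N ω → (z 1 = N + 1 ∧ -(N : ℤ) ≤ z 0 ∧ z 0 ≤ 0)) →
          (tW 1 = N ∧ -(N : ℤ) ≤ tW 0 ∧ tW 0 ≤ 0))) ∧
      PathIn triGraph SB tB eB ∧ PathIn triGraph SW tW eW := by
  classical
  have hW := latWind_startFace_ne_outerFace hadj hL hL₂
  obtain ⟨T, hT2, ⟨FT, hFT, hTouch⟩, hbefore, hwind⟩ := FourArmFlip.exists_touch hadj hP hW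
  -- the explored faces and the two chains
  set Fk : ℕ → HexVertex := fun k => (flipFace n N ω k).getD (startFace N) with hFkdef
  have hFk : ∀ k ≤ T, flipFace n N ω k = some (Fk k) := by
    intro k hk
    rcases Nat.lt_or_eq_of_le hk with hk | rfl
    · obtain ⟨G, hG, -⟩ := hbefore k hk
      rw [hFkdef]; simp only [hG, Option.getD_some]
    · rw [hFkdef]; simp only [hFT, Option.getD_some]
  have hnt : ∀ k < T, ¬ Touch n (Fk k) := by
    intro k hk
    obtain ⟨G, hG, hG'⟩ := hbefore k hk
    have := hFk k hk.le
    rw [hG] at this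
    cases this
    exact hG'
  have hT1 : 1 ≤ T := by
    by_contra h0
    obtain rfl : T = 0 := by omega
    simp only [flipFace_zero, Option.some.injEq] at hFT
    exact not_touch_startFace hnN (hFT ▸ hTouch)
  have hFT' : Fk T = oppFace (Fk (T - 1)) (exitIdx n N ω (Fk (T - 1))) := by
    have h := flipFace_succ_eq_oppFace_exitIdx (hFk (T - 1) (by omega)) (hnt (T - 1) (by omega))
    rw [Nat.sub_add_cancel hT1, hFk T le_rfl] at h
    exact Option.some_injective _ h
  have hTouch' : Touch n (oppFace (Fk (T - 1)) (exitIdx n N ω (Fk (T - 1)))) := by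
    rw [← hFT']
    have := hFk T le_rfl
    rw [hFT] at this
    cases this
    exact hTouch
  have hchain : ∀ k, k + 1 < T →
      (exitBlack n N ω (Fk (k + 1)) = exitBlack n N ω (Fk k) ∨ triGraph.Adj (exitBlack n N ω (Fk k)) (exitBlack n N ω (Fk (k + 1)))) ∧ (exitWhite n N ω (Fk (k + 1)) = exitWhite n N ω (Fk k) ∨ triGraph.Adj (exitWhite n N ω (Fk k)) (exitWhite n N ω (Fk (k + 1)))) :=
    fun k hk => exitSites_chain (hFk k (by omega)) (hnt k (by omega)) (hFk (k + 1) hk.le)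
  have hbk_mem : ∀ k < T, exitBlack n N ω (Fk k) ∈ flipConfig n N ω := fun k hk => exitBlack_mem (hFk k hk.le)
  have hwk_nmem : ∀ k < T, exitWhite n N ω (Fk k) ∉ flipConfig n N ω := fun k hk => exitWhite_not_mem (hFk k hk.le)
  have hbk_n : ∀ k < T, (n : ℤ) ≤ triNorm (exitBlack n N ω (Fk k)) := fun k hk => by
    by_contra h; exact hnt k hk ⟨_, not_le.1 h⟩
  have hwk_n : ∀ k < T, (n : ℤ) ≤ triNorm (exitWhite n N ω (Fk k)) := fun k hk => by
    by_contra h; exact hnt k hk ⟨_, not_le.1 h⟩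
  obtain ⟨hbT, hwT⟩ := triNorm_exitSites_le_of_touch (n := n) (N := N) (ω := ω) (hnt (T - 1) (by omega)) hTouch'
  -- examinedness and colours of the chain sites in the annulus
  have hstep : T - 1 < stepBound N := by omega
  have hbk_ex : ∀ k < T, triNorm (exitBlack n N ω (Fk k)) ≤ N → exitBlack n N ω (Fk k) ∈ examined n N ω ∧ exitBlack n N ω (Fk k) ∈ ω := fun k hk hkN =>
    ⟨exitBlack_mem_examined (by omega) (hFk k hk.le) (hbk_n k hk) hkN, exitBlack_mem_of_ann (hFk k hk.le) (hbk_n k hk) hkN⟩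
  have hwk_ex : ∀ k < T, triNorm (exitWhite n N ω (Fk k)) ≤ N → exitWhite n N ω (Fk k) ∈ examined n N ω ∧ exitWhite n N ω (Fk k) ∉ ω := fun k hk hkN =>
    ⟨exitWhite_mem_examined (by omega) (hFk k hk.le) (hwk_n k hk) hkN, exitWhite_not_mem_of_ann (hFk k hk.le) (hwk_n k hk) hkN⟩
  -- the real tails of the chains and their tips
  have hnN' : (n : ℤ) ≤ N := by exact_mod_cast hnN
  obtain ⟨s, hsT, hsA, hs0⟩ := exists_tail_start (fun k => exitBlack n N ω (Fk k)) {z | triNorm z ≤ N} hT1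
    (show triNorm (exitBlack n N ω (Fk (T - 1))) ≤ N from hbT.trans hnN')
  obtain ⟨s', hs'T, hs'A, hs'0⟩ := exists_tail_start (fun k => exitWhite n N ω (Fk k)) {z | triNorm z ≤ N} hT1
    (show triNorm (exitWhite n N ω (Fk (T - 1))) ≤ N from hwT.trans hnN')
  replace hsA : ∀ k, s ≤ k → k < T → triNorm (exitBlack n N ω (Fk k)) ≤ N := fun k hk hkT => hsA k hk hkT
  replace hs'A : ∀ k, s' ≤ k → k < T → triNorm (exitWhite n N ω (Fk k)) ≤ N := fun k hk hkT => hs'A k hk hkT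
  replace hs0 : s = 0 ∨ ¬ triNorm (exitBlack n N ω (Fk (s - 1))) ≤ N := hs0
  replace hs'0 : s' = 0 ∨ ¬ triNorm (exitWhite n N ω (Fk (s' - 1))) ≤ N := hs'0
  have htipB : (exitBlack n N ω (Fk s)) 0 + (exitBlack n N ω (Fk s)) 1 = N ∧ 0 ≤ (exitBlack n N ω (Fk s)) 0 ∧ triNorm (exitBlack n N ω (Fk s)) = N := by
    rcases hs0 with rfl | hs0
    · -- the corner `(0, N)`
      have h0 : Fk 0 = startFace N := by rw [hFkdef]; simp
      have hA : triNorm (exitBlack n N ω (Fk 0)) ≤ N := hsA 0 le_rfl (by omega)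
      have hb : exitBlack n N ω (Fk 0) = faceVertex (startFace N) (exitIdx n N ω (startFace N) + 2) := by
        show exitBlack n N ω (Fk 0) = _; rw [h0]; rfl
      rw [hb] at hA ⊢
      obtain ⟨h1, h2, h3⟩ := startFace_vertex_ann hA
      refine ⟨by rw [h1, h2]; simp, by rw [h1], h3⟩
    · have hs1 : 1 ≤ s := by
        by_contra h; obtain rfl : s = 0 := by omega
        exact hs0 (hsA 0 le_rfl (by omega))
      have hzT : s - 1 < T := by omega
      obtain ⟨hzN, hz0⟩ := exitBlack_ring_of_not_ann (hFk (s - 1) hzT.le) (fun h => hs0 h.2)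
      set z := exitBlack n N ω (Fk (s - 1)) with hz
      -- `z` is a ring vertex of an explored face, hence on the cycle: the black stretch
      have hzl : z ∈ faceVertex (startFace N) 2 :: l :=
        mem_cycle_of_ring_vertex hM hadj hL hL₂ (hwind (s - 1) (by omega) _ (hFk (s - 1) hzT.le)) hzN
      have hzform : 1 ≤ z 0 ∧ z 0 + z 1 = N + 1 := by
        rcases List.mem_cons.1 hzl with h | h
        · have := congrFun h 0; rw [faceVertex_startFace] at this; simp at this; omega
        · exact ⟨hz0, hringA z h hzN hz0⟩
      have hsucc : exitBlack n N ω (Fk s) = z ∨ triGraph.Adj z (exitBlack n N ω (Fk s)) := by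
        have := (hchain (s - 1) (by omega)).1
        rw [Nat.sub_add_cancel hs1] at this
        exact this
      have hsAnn : triNorm (exitBlack n N ω (Fk s)) ≤ N := hsA s le_rfl (by omega)
      rcases hsucc with h | h
      · rw [h] at hsAnn; omega
      · exact side1_of_adj_ringA hzform.1 hzform.2 hzN h hsAnn
  have htipW : triNorm (exitWhite n N ω (Fk s')) = N ∧
      ((∀ z ∈ l, triNorm z = N + 1 → z ∉ flipConfig n N ω → (z 1 = N + 1 ∧ -(N : ℤ) ≤ z 0 ∧ z 0 ≤ 0)) →
        ((exitWhite n N ω (Fk s')) 1 = N ∧ -(N : ℤ) ≤ (exitWhite n N ω (Fk s')) 0 ∧ (exitWhite n N ω (Fk s')) 0 ≤ 0)) := by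
    rcases hs'0 with rfl | hs'0
    · have h0 : Fk 0 = startFace N := by rw [hFkdef]; simp
      have hA : triNorm (exitWhite n N ω (Fk 0)) ≤ N := hs'A 0 le_rfl (by omega)
      have hb : exitWhite n N ω (Fk 0) = faceVertex (startFace N) (exitIdx n N ω (startFace N) + 1) := by
        show exitWhite n N ω (Fk 0) = _; rw [h0]; rfl
      rw [hb] at hA ⊢
      obtain ⟨h1, h2, h3⟩ := startFace_vertex_ann hA
      exact ⟨h3, fun _ => ⟨h2, by rw [h1]; omega, by rw [h1]⟩⟩
    · have hs1 : 1 ≤ s' := by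
        by_contra h; obtain rfl : s' = 0 := by omega
        exact hs'0 (hs'A 0 le_rfl (by omega))
      have hzT : s' - 1 < T := by omega
      have hzn := hwk_n (s' - 1) hzT
      have hzw : exitWhite n N ω (Fk (s' - 1)) ∉ flipConfig n N ω := hwk_nmem (s' - 1) hzT
      set z := exitWhite n N ω (Fk (s' - 1)) with hz
      have hsAnn : triNorm (exitWhite n N ω (Fk s')) ≤ N := hs'A s' le_rfl (by omega)
      have hsucc : exitWhite n N ω (Fk s') = z ∨ triGraph.Adj z (exitWhite n N ω (Fk s')) := by
        have := (hchain (s' - 1) (by omega)).2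
        rw [Nat.sub_add_cancel hs1] at this
        exact this
      have hadj' : triGraph.Adj z (exitWhite n N ω (Fk s')) := by
        rcases hsucc with h | h
        · rw [h] at hsAnn; exact absurd hsAnn hs'0
        · exact h
      -- `z` has norm `N + 1`: it is adjacent to the real tip and not in the annulus
      have hzN : triNorm z = N + 1 := by
        have h1 := triNorm_le_triNorm_add_one_of_adj' hadj'
        have h2 : ¬ triNorm z ≤ N := hs'0
        omega
      have hwN : triNorm (exitWhite n N ω (Fk s')) = N := by
        have h1 := triNorm_le_triNorm_add_one_of_adj' hadj'
        omega
      refine ⟨hwN, fun hringB => ?_⟩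
      have hzl : z ∈ faceVertex (startFace N) 2 :: l :=
        mem_cycle_of_ring_vertex hM hadj hL hL₂ (hwind (s' - 1) (by omega) _ (hFk (s' - 1) hzT.le)) (j := _) hzN
      rcases List.mem_cons.1 hzl with h | h
      · -- `z = (0, N + 1)`
        have h0 : z 0 = 0 := by rw [h, faceVertex_startFace]; simp
        have h1 : z 1 = N + 1 := by rw [h, faceVertex_startFace]; simp
        obtain ⟨e1, e2, e3, -⟩ := side2_of_adj_ringB₂ (by rw [h0]; omega) (by rw [h0]) h1 hadj' hsAnn
        exact ⟨e1, e2, e3⟩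
      · obtain ⟨h1, h2, h3⟩ := hringB z h hzN hzw
        obtain ⟨e1, e2, e3, -⟩ := side2_of_adj_ringB₂ h2 h3 h1 hadj' hsAnn
        exact ⟨e1, e2, e3⟩
  -- the chains as sets
  set S2 : Set (Site 2) := {z | ∃ k, s ≤ k ∧ k < T ∧ z = exitBlack n N ω (Fk k)} with hS2
  set S3 : Set (Site 2) := {z | ∃ k, s' ≤ k ∧ k < T ∧ z = exitWhite n N ω (Fk k)} with hS3
  have c2 : ∀ z ∈ S2, z ∈ examined n N ω ∧ z ∈ ω ∧ (n : ℤ) ≤ triNorm z ∧ triNorm z ≤ N := by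
    rintro z ⟨k, hk, hkT, rfl⟩
    obtain ⟨hex, hω'⟩ := hbk_ex k hkT (hsA k hk hkT)
    exact ⟨hex, hω', hbk_n k hkT, hsA k hk hkT⟩
  have c3 : ∀ z ∈ S3, z ∈ examined n N ω ∧ z ∉ ω ∧ (n : ℤ) ≤ triNorm z ∧ triNorm z ≤ N := by
    rintro z ⟨k, hk, hkT, rfl⟩
    obtain ⟨hex, hω'⟩ := hwk_ex k hkT (hs'A k hk hkT)
    exact ⟨hex, hω', hwk_n k hkT, hs'A k hk hkT⟩
  -- paths along the chains
  have hpathB : ∀ m, s ≤ m → m < T → PathIn triGraph S2 (exitBlack n N ω (Fk s)) (exitBlack n N ω (Fk m)) :=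
    pathIn_of_seq (fun k => exitBlack n N ω (Fk k)) (fun k hk hkT => (hchain k hkT).1) fun k hk hkT => ⟨k, hk, hkT, rfl⟩
  have hpathW : ∀ m, s' ≤ m → m < T → PathIn triGraph S3 (exitWhite n N ω (Fk s')) (exitWhite n N ω (Fk m)) :=
    pathIn_of_seq (fun k => exitWhite n N ω (Fk k)) (fun k hk hkT => (hchain k hkT).2) fun k hk hkT => ⟨k, hk, hkT, rfl⟩
  have hbTn : triNorm (exitBlack n N ω (Fk (T - 1))) = n := le_antisymm hbT (hbk_n _ (by omega))
  have hwTn : triNorm (exitWhite n N ω (Fk (T - 1))) = n := le_antisymm hwT (hwk_n _ (by omega))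
  exact ⟨S2, S3, exitBlack n N ω (Fk s), exitBlack n N ω (Fk (T - 1)), exitWhite n N ω (Fk s'),
    exitWhite n N ω (Fk (T - 1)), fun z hz => c2 z hz, fun z hz => c3 z hz, hbTn, hwTn, htipB, htipW,
    hpathB (T - 1) (by omega) (by omega), hpathW (T - 1) (by omega) (by omega)⟩



/-! ### The input event -/

/-- **Five landed arms with one black arm**: pairwise disjoint sets of sites `S₀, …, S₄` of the
annulus `{n ≤ |·|_𝕋 ≤ N}`, `S₀` black, the others white, the `j`-th carrying a `𝕋`-path from a site
of `∂Λ_n` to a site strictly inside side `j` of `∂Λ_N` (Nolin's `Ā^{·/I}_{5,σ}(n, N)`, `σ = BWWWW`,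
`I_j` = the interior of side `j`, without free spaces). [cite: Nolin2008, §4.2 Def. 8 and §5.1 Prop. 20 (arXiv 0711.4948: Def. 8, Prop. 19)] -/
def landedOneFour (n N : ℕ) : Set (SiteConfig (Site 2)) :=
  {ω | ∃ (S : Fin 5 → Set (Site 2)) (x y : Fin 5 → Site 2),
    (Pairwise fun i j => Disjoint (S i) (S j)) ∧
    (∀ j, S j ⊆ {v | (n : ℤ) ≤ triNorm v ∧ triNorm v ≤ N}) ∧
    (∀ v ∈ S 0, v ∈ ω) ∧ (∀ j, j ≠ 0 → ∀ v ∈ S j, v ∉ ω) ∧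
    (∀ j, triNorm (x j) = n ∧ PathIn triGraph (S j) (x j) (y j)) ∧
    (y 0 0 = N ∧ -(N : ℤ) < y 0 1 ∧ y 0 1 < 0) ∧
    (y 1 0 + y 1 1 = N ∧ 0 < y 1 0 ∧ y 1 0 < N) ∧
    (y 2 1 = N ∧ -(N : ℤ) < y 2 0 ∧ y 2 0 < 0) ∧
    (y 3 0 = -(N : ℤ) ∧ 0 < y 3 1 ∧ y 3 1 < N) ∧
    (y 4 0 + y 4 1 = -(N : ℤ) ∧ -(N : ℤ) < y 4 0 ∧ y 4 0 < 0)}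

/-! ### The two frames and their examined sets -/

/-- **Frame A**: the configuration rotated by `ρ⁵`, `v ∈ frameA ω ↔ ρ⁵ v ∈ ω`; the site `ρ z`
of the frame corresponds to the site `z` (`ρ⁶ = id`), so that side `0` of `ω` is side `1` of the
frame and side `1` is side `2`: the machine of `FlipFourArm.lean` then explores the interface
between `B(0)` and `W(1)`. [cite: Nolin2008, §5.1 Prop. 20 (arXiv 0711.4948: Prop. 19)] -/
def frameA (ω : SiteConfig (Site 2)) : SiteConfig (Site 2) := rotConfig 5 ω

/-- **Frame B**: colours exchanged and rotated by `ρ³` (central symmetry),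
`v ∈ frameB ω ↔ ρ³ v ∉ ω`; side `4` of `ω` is side `1` of the frame (white becomes black) and
side `0` is side `3` (black becomes white): the machine explores the interface between `W(4)` and
`B(0)`. [cite: Nolin2008, §5.1 Prop. 20 (arXiv 0711.4948: Prop. 19)] -/
def frameB (ω : SiteConfig (Site 2)) : SiteConfig (Site 2) := rotConfig 3 ωᶜ

/-- Membership in frame A. [folklore] -/
@[simp] theorem mem_frameA {ω : SiteConfig (Site 2)} {v : Site 2} : v ∈ frameA ω ↔ triRotIsoPow 5 v ∈ ω := by
  rw [frameA, mem_rotConfig]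

/-- Membership in frame B. [folklore] -/
@[simp] theorem mem_frameB {ω : SiteConfig (Site 2)} {v : Site 2} : v ∈ frameB ω ↔ triRotIsoPow 3 v ∉ ω := by
  rw [frameB, mem_rotConfig, Set.mem_compl_iff]

/-- `ρ (ρ³ z) = ρ⁴ z`. [folklore] -/
theorem rot1_rot3 (z : Site 2) : triRotIsoPow 1 (triRotIsoPow 3 z) = triRotIsoPow 4 z := by
  rw [← triRotIsoPow_add_apply]

/-- `ρ⁵ (ρ⁴ z) = ρ³ z`. [folklore] -/
theorem rot5_rot4 (z : Site 2) : triRotIsoPow 5 (triRotIsoPow 4 z) = triRotIsoPow 3 z := by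
  rw [← triRotIsoPow_add_apply, show 4 + 5 = 3 + 6 from rfl, triRotIsoPow_add_six_apply]

/-- **The examined set of frame A, in the original coordinates**: `ρ⁵(examined (frameA ω))`. [cite: BollobasRiordan2006, Ch. 7 proof of Lemma 6 p. 173] -/
def examinedA (n N : ℕ) (ω : SiteConfig (Site 2)) : Finset (Site 2) :=
  (examined n N (frameA ω)).image (triRotIsoPow 5)

/-- **The examined set of frame B, in the original coordinates**: `ρ³(examined (frameB ω))`. [cite: BollobasRiordan2006, Ch. 7 proof of Lemma 6 p. 173] -/
def examinedB (n N : ℕ) (ω : SiteConfig (Site 2)) : Finset (Site 2) :=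
  (examined n N (frameB ω)).image (triRotIsoPow 3)

/-- **The examined set of the double exploration.** [cite: Nolin2008, §5.1 Prop. 20 (arXiv 0711.4948: Prop. 19: "any set of consecutive arms")] -/
def examinedAB (n N : ℕ) (ω : SiteConfig (Site 2)) : Finset (Site 2) := examinedA n N ω ∪ examinedB n N ω

/-- Membership in `examinedA`: `z` is examined iff `ρ z` is examined in frame A. [folklore] -/
theorem mem_examinedA {ω : SiteConfig (Site 2)} {z : Site 2} :
    z ∈ examinedA n N ω ↔ triRotIsoPow 1 z ∈ examined n N (frameA ω) := by
  rw [examinedA, Finset.mem_image]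
  constructor
  · rintro ⟨v, hv, rfl⟩; rwa [rot1_rot5]
  · intro h; exact ⟨_, h, rot5_rot1 z⟩

/-- Membership in `examinedB`: `z` is examined iff `ρ³ z` is examined in frame B. [folklore] -/
theorem mem_examinedB {ω : SiteConfig (Site 2)} {z : Site 2} :
    z ∈ examinedB n N ω ↔ triRotIsoPow 3 z ∈ examined n N (frameB ω) := by
  rw [examinedB, Finset.mem_image]
  constructor
  · rintro ⟨v, hv, rfl⟩; rwa [rot3_rot3]
  · intro h; exact ⟨_, h, rot3_rot3 z⟩

/-- The examined sets lie in the annulus. [folklore] -/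
theorem examinedAB_subset (ω : SiteConfig (Site 2)) : examinedAB n N ω ⊆ triAnnulus n N := by
  intro z hz
  rw [examinedAB, Finset.mem_union] at hz
  rw [mem_triAnnulus]
  rcases hz with hz | hz
  · have h := examined_subset _ (mem_examinedA.1 hz)
    rw [mem_triAnnulus, triNorm_rot] at h
    exact h
  · have h := examined_subset _ (mem_examinedB.1 hz)
    rw [mem_triAnnulus, triNorm_rot] at h
    exact h

/-- **The union of the two examined sets is a stopping set**: configurations agreeing on it agree,
in each frame, on that frame's examined set, which therefore does not change
(`FourArmFlip.examined_congr`). [cite: BollobasRiordan2006, Ch. 7 proof of Lemma 6 p. 175] -/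
theorem isStoppingSet_examinedAB (n N : ℕ) : IsStoppingSet (examinedAB n N) := by
  intro ω ω' h
  have hA : examined n N (frameA ω') = examined n N (frameA ω) := by
    refine examined_congr fun v hv => ?_
    have h' := h (triRotIsoPow 5 v) (by
      rw [examinedAB, Finset.mem_union]; left
      exact mem_examinedA.2 (by rwa [rot1_rot5]))
    rw [mem_frameA, mem_frameA]
    exact h'
  have hB : examined n N (frameB ω') = examined n N (frameB ω) := by
    refine examined_congr fun v hv => ?_
    have h' := h (triRotIsoPow 3 v) (by
      rw [examinedAB, Finset.mem_union]; right
      exact mem_examinedB.2 (by rwa [rot3_rot3]))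
    rw [mem_frameB, mem_frameB]
    exact not_congr h'
  rw [examinedAB, examinedAB, examinedA, examinedA, examinedB, examinedB, hA, hB]

/-! ### The flip -/

/-- **The double-exploration flip**: change the state of every site of the annulus
`triAnnulus n N` off `examinedAB n N ω` (Nolin: "We can then 'flip' the remaining region"). [cite: Nolin2008, §5.1 Prop. 20 (arXiv 0711.4948: Prop. 19)] [cite: BollobasRiordan2006, Ch. 7 proof of Lemma 6 p. 175] -/
def fiveArmFlip (n N : ℕ) : SiteConfig (Site 2) → SiteConfig (Site 2) :=
  stopFlip (triAnnulus n N) (examinedAB n N)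

/-- The flip keeps the states of the examined sites. [folklore] -/
theorem mem_fiveArmFlip_iff_of_mem {ω : SiteConfig (Site 2)} {v : Site 2} (hv : v ∈ examinedAB n N ω) :
    v ∈ fiveArmFlip n N ω ↔ v ∈ ω :=
  mem_stopFlip_iff_of_mem hv

/-- The flip changes the states of the unexamined sites of the annulus. [folklore] -/
theorem mem_fiveArmFlip_iff_of_not_mem {ω : SiteConfig (Site 2)} {v : Site 2} (hv : v ∈ triAnnulus n N)
    (hv' : v ∉ examinedAB n N ω) : v ∈ fiveArmFlip n N ω ↔ v ∉ ω :=
  mem_stopFlip_iff_of_mem_sdiff hv hv'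

/-- **The flip preserves `P_{1/2}`** on events determined by the annulus (Bollobás–Riordan:
"`ω ↦ ω'` is a measure-preserving bijection"). [cite: BollobasRiordan2006, Ch. 7 proof of Lemma 6 p. 175] -/
theorem real_preimage_fiveArmFlip {A : Set (SiteConfig (Site 2))} (hA : DeterminedBy A ↑(triAnnulus n N)) :
    (triSitePercolation half).real (fiveArmFlip n N ⁻¹' A) = (triSitePercolation half).real A :=
  (isStoppingSet_examinedAB n N).sitePercolation_half_real_preimage_stopFlip examinedAB_subset hA

/-! ### The flip maps the landed `(B,W,W,W,W)` arms into the arm event `(B,W,B,B,W)` -/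

/-- Coordinates of `ρ u`, `ρ³ u`, `ρ⁴ u`. [folklore] -/
theorem rot134_apply (u : Site 2) :
    ((triRotIsoPow 1 u) 0 = -u 1 ∧ (triRotIsoPow 1 u) 1 = u 0 + u 1) ∧
    ((triRotIsoPow 3 u) 0 = -u 0 ∧ (triRotIsoPow 3 u) 1 = -u 1) ∧
    ((triRotIsoPow 4 u) 0 = u 1 ∧ (triRotIsoPow 4 u) 1 = -(u 0 + u 1)) := by
  obtain ⟨-, -, h10, h11, -, -, h30, h31, h40, h41, -⟩ := rot_apply_formula u
  exact ⟨⟨h10, h11⟩, ⟨h30, h31⟩, ⟨h40, h41⟩⟩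

/-- Images of disjoint sets under a rotation are disjoint (pointwise form). [folklore] -/
theorem not_mem_image_rot_of_disjoint {k : ℕ} {A B : Set (Site 2)} (h : ∀ z ∈ A, z ∉ B) {v : Site 2}
    (hv : v ∈ triRotIsoPow k '' A) : v ∉ triRotIsoPow k '' B := by
  rintro ⟨u', hu', hu'v⟩
  obtain ⟨u, hu, rfl⟩ := hv
  have : u' = u := (triRotIsoPow k).injective hu'v
  exact h u hu (this ▸ hu')

section Frames

variable {ω : SiteConfig (Site 2)} {T : Fin 5 → Set (Site 2)} {y : Fin 5 → Site 2}

set_option maxHeartbeats 1600000 in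
/-- **Frame A** (`ρ`; `B(0)` on side `1`, `W(1)` on side `2` of the frame). From five landed arms
(tight supports `T j`, every site joined inside `T j` to the tip `y j`): the examined black chain
`Z₀ ⊆ ω` and white chain `Z₁ ⊆ ωᶜ` of the exploration (`explore_chains`, in the original
coordinates), each carrying a path of the annulus from `∂Λ_N` to `∂Λ_n`; the arms `T 2, T 3, T 4`
(sides `3, 4, 5` of the frame) are unexamined; and any set of annulus sites of the frame off the two
explored arms, joined inside itself to a site of side `5` of the frame, is unexamined
(`not_mem_examined_of_escape`). [cite: Nolin2008, §5.1 Prop. 20 (arXiv 0711.4948: Prop. 19)] [cite: BollobasRiordan2006, Ch. 7 Lemma 6 and Claims 7–9 pp. 172–175] -/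
theorem frameA_pack (hn : 1 ≤ n) (hnN : n ≤ N)
    (hTann : ∀ j, ∀ z ∈ T j, (n : ℤ) ≤ triNorm z ∧ triNorm z ≤ N)
    (hTdisj : ∀ i j, i ≠ j → ∀ z ∈ T i, z ∉ T j)
    (hT0 : ∀ z ∈ T 0, z ∈ ω) (hTW : ∀ j, j ≠ 0 → ∀ z ∈ T j, z ∉ ω)
    (hTne : ∀ j, ∃ x ∈ T j, triNorm x = n) (hTall : ∀ j, ∀ z ∈ T j, PathIn triGraph (T j) z (y j))
    (hyN : ∀ j, triNorm (y j) = N)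
    (hy0 : y 0 0 = N ∧ -(N : ℤ) < y 0 1 ∧ y 0 1 < 0) (hy1 : y 1 0 + y 1 1 = N ∧ 0 < y 1 0 ∧ y 1 0 < N)
    (hy2 : y 2 1 = N ∧ -(N : ℤ) < y 2 0 ∧ y 2 0 < 0) (hy3 : y 3 0 = -(N : ℤ) ∧ 0 < y 3 1 ∧ y 3 1 < N)
    (hy4 : y 4 0 + y 4 1 = -(N : ℤ) ∧ -(N : ℤ) < y 4 0 ∧ y 4 0 < 0) :
    ∃ (Z0 Z1 : Set (Site 2)) (e0 t0 e1 t1 : Site 2),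
      (∀ z ∈ Z0, z ∈ ω ∧ z ∈ examinedA n N ω ∧ (n : ℤ) ≤ triNorm z ∧ triNorm z ≤ N) ∧
      (∀ z ∈ Z1, z ∉ ω ∧ z ∈ examinedA n N ω ∧ (n : ℤ) ≤ triNorm z ∧ triNorm z ≤ N) ∧
      triNorm e0 = n ∧ triNorm t0 = N ∧ triNorm e1 = n ∧ triNorm t1 = N ∧
      PathIn triGraph Z0 e0 t0 ∧ PathIn triGraph Z1 e1 t1 ∧
      (∀ j, j ≠ 0 → j ≠ 1 → ∀ u ∈ T j, u ∉ examinedA n N ω) ∧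
      (∀ (A' : Set (Site 2)) (t : Site 2),
        (∀ v ∈ A', (n : ℤ) ≤ triNorm v ∧ triNorm v ≤ N ∧ v ∉ triRotIsoPow 1 '' T 0 ∧ v ∉ triRotIsoPow 1 '' T 1) →
        (∀ v ∈ A', PathIn triGraph A' v t) → t 1 = -(N : ℤ) → 0 ≤ t 0 → t 0 ≤ N →
        ∀ v ∈ A', v ∉ examined n N (frameA ω)) := by
  classical
  have hnN' : (n : ℤ) ≤ N := by exact_mod_cast hnN
  set ωA := frameA ω with hωA
  have colA : ∀ u : Site 2, (triRotIsoPow 1 u ∈ ωA ↔ u ∈ ω) := fun u => by rw [hωA, mem_frameA, rot5_rot1]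
  have annA : ∀ j, ∀ v ∈ triRotIsoPow 1 '' T j, (n : ℤ) ≤ triNorm v ∧ triNorm v ≤ N := by
    rintro j _ ⟨u, hu, rfl⟩; rw [triNorm_rot]; exact hTann j u hu
  -- the two explored arms of frame A as walks
  obtain ⟨x0, hx0, hx0n⟩ := hTne 0
  obtain ⟨x1, hx1, hx1n⟩ := hTne 1
  obtain ⟨p₁, hp₁⟩ := (pathIn_map_iso (triRotIsoPow 1) (hTall 0 x0 hx0)).exists_walk
  obtain ⟨p₂, hp₂⟩ := (pathIn_map_iso (triRotIsoPow 1) (hTall 1 x1 hx1)).exists_walk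
  have hp₁' : ∀ z ∈ p₁.support, (n : ℤ) ≤ triNorm z ∧ triNorm z ≤ N ∧ z ∈ ωA := by
    intro z hz
    obtain ⟨u, hu, rfl⟩ := hp₁ z hz
    exact ⟨(annA 0 _ ⟨u, hu, rfl⟩).1, (annA 0 _ ⟨u, hu, rfl⟩).2, (colA u).2 (hT0 u hu)⟩
  have hp₂' : ∀ z ∈ p₂.support, (n : ℤ) ≤ triNorm z ∧ triNorm z ≤ N ∧ z ∉ ωA := by
    intro z hz
    obtain ⟨u, hu, rfl⟩ := hp₂ z hz
    exact ⟨(annA 1 _ ⟨u, hu, rfl⟩).1, (annA 1 _ ⟨u, hu, rfl⟩).2, fun h => hTW 1 (by decide) u hu ((colA u).1 h)⟩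
  obtain ⟨⟨r10, r11⟩, -, -⟩ := rot134_apply (y 0)
  obtain ⟨⟨r20, r21⟩, -, -⟩ := rot134_apply (y 1)
  obtain ⟨lA, hMA, hadjA, hPA, ⟨L₂A, hLA, hL₂A⟩, hmemA⟩ := exists_flipCycle₂ hn hnN (ω := ωA) p₁ p₂
    (by rw [triNorm_rot]; exact hx0n) (by rw [triNorm_rot]; exact hx1n)
    (by rw [r10, r11]; omega) (by rw [triNorm_rot]; exact hyN 0) (by rw [r21]; omega)
    (by rw [triNorm_rot]; exact hyN 1) (by rw [r20]; omega) hp₁' hp₂'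
  -- the cycle in terms of the arm sets
  have hmemA' : ∀ z ∈ lA, z ∈ triRotIsoPow 1 '' T 0 ∨ z ∈ triRotIsoPow 1 '' T 1 ∨ triNorm z < n ∨
      (triNorm z = N + 1 ∧ ((z 1 = N + 1 ∧ -(N : ℤ) ≤ z 0 ∧ z 0 ≤ -1) ∨
        (1 ≤ z 0 ∧ z 0 ≤ (triRotIsoPow 1 (y 0)) 0 + 1 ∧ z 0 + z 1 = N + 1))) :=
    fun z hz => (hmemA z hz).imp (hp₁ z) fun h => h.imp (hp₂ z) id
  have hP₁A : ∀ z ∈ triRotIsoPow 1 '' T 0, triNorm z ≤ N := fun z hz => (annA 0 z hz).2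
  have hP₂A : ∀ z ∈ triRotIsoPow 1 '' T 1, triNorm z ≤ N := fun z hz => (annA 1 z hz).2
  have hringA_A : ∀ z ∈ lA, triNorm z = N + 1 → 1 ≤ z 0 → z 0 + z 1 = N + 1 := by
    intro z hz hzN hz0
    rcases hmemA' z hz with h | h | h | ⟨-, ⟨-, -, h⟩ | ⟨-, -, h⟩⟩
    · have := hP₁A z h; omega
    · have := hP₂A z h; omega
    · omega
    · omega
    · exact h
  have hringB_A : ∀ z ∈ lA, triNorm z = N + 1 → z ∉ flipConfig n N ωA →
      (z 1 = N + 1 ∧ -(N : ℤ) ≤ z 0 ∧ z 0 ≤ 0) := by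
    intro z hz hzN hzw
    rcases hmemA' z hz with h | h | h | ⟨-, ⟨h1, h2, h3⟩ | ⟨h1, -, -⟩⟩
    · have := hP₁A z h; omega
    · have := hP₂A z h; omega
    · omega
    · exact ⟨h1, h2, by omega⟩
    · exact absurd (show z ∈ flipConfig n N ωA from Or.inr ⟨hzN, h1⟩) hzw
  -- the two chains of frame A
  obtain ⟨SB, SW, tB, eB, tW, eW, hSB, hSW, heB, heW, htB, htW, hpB, hpW⟩ :=
    explore_chains hnN hMA hadjA hPA hLA hL₂A hringA_A
  -- the generic escape beyond side `5` of the frame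
  have esc5 : ∀ (A' : Set (Site 2)) (t : Site 2),
      (∀ v ∈ A', (n : ℤ) ≤ triNorm v ∧ triNorm v ≤ N ∧ v ∉ triRotIsoPow 1 '' T 0 ∧ v ∉ triRotIsoPow 1 '' T 1) →
      (∀ v ∈ A', PathIn triGraph A' v t) → t 1 = -(N : ℤ) → 0 ≤ t 0 → t 0 ≤ N →
      ∀ v ∈ A', v ∉ examined n N ωA := by
    intro A' t hA' hjoin ht1 ht0 ht0' v hv
    obtain ⟨he₁, he₂, had₁, had₂⟩ := escape_side5 (N := N) (y := t) ht1 ht0 ht0'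
    exact not_mem_examined_of_escape hMA hadjA hPA hLA hL₂A
      (fun w hw => not_mem_cycle₂_of_ann hmemA' (hA' w hw).1 (hA' w hw).2.1 (hA' w hw).2.2.1 (hA' w hw).2.2.2)
      hjoin (not_mem_cycle₂_of_ring hnN hP₁A hP₂A hmemA' he₁ (by simp; omega) (by simp; omega)) he₂ had₁ had₂ v hv
  -- arms off the cycle of frame A are unexamined there
  have offA : ∀ j, j ≠ 0 → j ≠ 1 → ∀ v ∈ triRotIsoPow 1 '' T j, v ∉ faceVertex (startFace N) 2 :: lA := by
    intro j hj0 hj1 v hv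
    exact not_mem_cycle₂_of_ann hmemA' (annA j v hv).1 (annA j v hv).2
      (not_mem_image_rot_of_disjoint (hTdisj j 0 hj0) hv) (not_mem_image_rot_of_disjoint (hTdisj j 1 hj1) hv)
  have joinA : ∀ j, ∀ v ∈ triRotIsoPow 1 '' T j, PathIn triGraph (triRotIsoPow 1 '' T j) v (triRotIsoPow 1 (y j)) := by
    rintro j _ ⟨u, hu, rfl⟩
    exact pathIn_map_iso (triRotIsoPow 1) (hTall j u hu)
  have exA_of : ∀ j, (∀ v ∈ triRotIsoPow 1 '' T j, v ∉ examined n N ωA) → ∀ u ∈ T j, u ∉ examinedA n N ω := by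
    intro j h u hu hex
    exact h _ ⟨u, hu, rfl⟩ (mem_examinedA.1 hex)
  -- arm 2: side 3 of frame A
  have hA2 : ∀ u ∈ T 2, u ∉ examinedA n N ω := by
    obtain ⟨⟨s0, s1⟩, -, -⟩ := rot134_apply (y 2)
    obtain ⟨he₁, he₂, had₁, had₂⟩ := escape_side3 (N := N) (y := triRotIsoPow 1 (y 2)) (by rw [s0]; omega)
      (by rw [s1]; omega) (by rw [s1]; omega)
    exact exA_of 2 (not_mem_examined_of_escape hMA hadjA hPA hLA hL₂A (offA 2 (by decide) (by decide)) (joinA 2)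
      (not_mem_cycle₂_of_ring hnN hP₁A hP₂A hmemA' he₁ (by simp; omega) (by simp)) he₂ had₁ had₂)
  -- arm 3: side 4 of frame A
  have hA3 : ∀ u ∈ T 3, u ∉ examinedA n N ω := by
    obtain ⟨⟨s0, s1⟩, -, -⟩ := rot134_apply (y 3)
    obtain ⟨he₁, he₂, had₁, had₂⟩ := escape_side4 (N := N) (y := triRotIsoPow 1 (y 3)) (by rw [s0, s1]; omega)
      (by rw [s0]; omega) (by rw [s0]; omega)
    exact exA_of 3 (not_mem_examined_of_escape hMA hadjA hPA hLA hL₂A (offA 3 (by decide) (by decide)) (joinA 3)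
      (not_mem_cycle₂_of_ring hnN hP₁A hP₂A hmemA' he₁ (by simp; omega) (by simp; omega)) he₂ had₁ had₂)
  -- arm 4: side 5 of frame A
  have hA4 : ∀ u ∈ T 4, u ∉ examinedA n N ω := by
    obtain ⟨⟨s0, s1⟩, -, -⟩ := rot134_apply (y 4)
    refine exA_of 4 (esc5 _ (triRotIsoPow 1 (y 4)) (fun v hv => ⟨(annA 4 v hv).1, (annA 4 v hv).2,
      not_mem_image_rot_of_disjoint (hTdisj 4 0 (by decide)) hv,
      not_mem_image_rot_of_disjoint (hTdisj 4 1 (by decide)) hv⟩) (joinA 4) (by rw [s1]; omega)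
      (by rw [s0]; omega) (by rw [s0]; omega))
  -- output, in the original coordinates
  refine ⟨triRotIsoPow 5 '' SB, triRotIsoPow 5 '' SW, triRotIsoPow 5 eB, triRotIsoPow 5 tB,
    triRotIsoPow 5 eW, triRotIsoPow 5 tW, ?_, ?_, by rw [triNorm_rot]; exact heB,
    by rw [triNorm_rot]; exact htB.2.2, by rw [triNorm_rot]; exact heW, by rw [triNorm_rot]; exact htW.1,
    (pathIn_map_iso (triRotIsoPow 5) hpB).symm, (pathIn_map_iso (triRotIsoPow 5) hpW).symm, ?_, esc5⟩
  · rintro _ ⟨v, hv, rfl⟩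
    obtain ⟨h1, h2, h3, h4⟩ := hSB hv
    exact ⟨by rw [hωA, mem_frameA] at h2; exact h2, mem_examinedA.2 (by rw [rot1_rot5]; exact h1),
      by rw [triNorm_rot]; exact h3, by rw [triNorm_rot]; exact h4⟩
  · rintro _ ⟨v, hv, rfl⟩
    obtain ⟨h1, h2, h3, h4⟩ := hSW hv
    exact ⟨by rw [hωA, mem_frameA] at h2; exact h2, mem_examinedA.2 (by rw [rot1_rot5]; exact h1),
      by rw [triNorm_rot]; exact h3, by rw [triNorm_rot]; exact h4⟩
  · intro j hj0 hj1
    fin_cases j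
    · exact absurd rfl hj0
    · exact absurd rfl hj1
    · exact hA2
    · exact hA3
    · exact hA4

set_option maxHeartbeats 1600000 in
/-- **Frame B** (`ρ³` and colour exchange; `W(4)` on side `1` as a black arm, `B(0)` on side `3`
as a white arm of the frame). The examined chain `Z₄ ⊆ ωᶜ` of the exploration
(`FourArmFlip.exists_flipCycle`, `explore_chains`), in the original coordinates, every site of
which is joined inside `Z₄` to its tip `t₄` on side `4` of `∂Λ_N`, with an end on `∂Λ_n`; and the
arms `T 1, T 2, T 3` (sides `4, 5, 0` of the frame) are unexamined. [cite: Nolin2008, §5.1 Prop. 20 (arXiv 0711.4948: Prop. 19)] [cite: BollobasRiordan2006, Ch. 7 Lemma 6 and Claims 7–9 pp. 172–175] -/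
theorem frameB_pack (hn : 1 ≤ n) (hnN : n ≤ N)
    (hTann : ∀ j, ∀ z ∈ T j, (n : ℤ) ≤ triNorm z ∧ triNorm z ≤ N)
    (hTdisj : ∀ i j, i ≠ j → ∀ z ∈ T i, z ∉ T j)
    (hT0 : ∀ z ∈ T 0, z ∈ ω) (hTW : ∀ j, j ≠ 0 → ∀ z ∈ T j, z ∉ ω)
    (hTne : ∀ j, ∃ x ∈ T j, triNorm x = n) (hTall : ∀ j, ∀ z ∈ T j, PathIn triGraph (T j) z (y j))
    (hyN : ∀ j, triNorm (y j) = N)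
    (hy0 : y 0 0 = N ∧ -(N : ℤ) < y 0 1 ∧ y 0 1 < 0) (hy1 : y 1 0 + y 1 1 = N ∧ 0 < y 1 0 ∧ y 1 0 < N)
    (hy2 : y 2 1 = N ∧ -(N : ℤ) < y 2 0 ∧ y 2 0 < 0) (hy3 : y 3 0 = -(N : ℤ) ∧ 0 < y 3 1 ∧ y 3 1 < N)
    (hy4 : y 4 0 + y 4 1 = -(N : ℤ) ∧ -(N : ℤ) < y 4 0 ∧ y 4 0 < 0) :
    ∃ (Z4 : Set (Site 2)) (e4 t4 : Site 2),
      (∀ z ∈ Z4, z ∉ ω ∧ z ∈ examinedB n N ω ∧ (n : ℤ) ≤ triNorm z ∧ triNorm z ≤ N) ∧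
      triNorm e4 = n ∧ triNorm t4 = N ∧ (t4 0 + t4 1 = -(N : ℤ) ∧ -(N : ℤ) ≤ t4 0 ∧ t4 0 ≤ 0) ∧
      PathIn triGraph Z4 e4 t4 ∧ (∀ z ∈ Z4, PathIn triGraph Z4 z t4) ∧
      (∀ j, j ≠ 4 → j ≠ 0 → ∀ u ∈ T j, u ∉ examinedB n N ω) := by
  classical
  have hnN' : (n : ℤ) ≤ N := by exact_mod_cast hnN
  set ωB := frameB ω with hωB
  have colB : ∀ u : Site 2, (triRotIsoPow 3 u ∈ ωB ↔ u ∉ ω) := fun u => by rw [hωB, mem_frameB, rot3_rot3]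
  have annB : ∀ j, ∀ v ∈ triRotIsoPow 3 '' T j, (n : ℤ) ≤ triNorm v ∧ triNorm v ≤ N := by
    rintro j _ ⟨u, hu, rfl⟩; rw [triNorm_rot]; exact hTann j u hu
  obtain ⟨x4, hx4, hx4n⟩ := hTne 4
  obtain ⟨x0, hx0, hx0n⟩ := hTne 0
  obtain ⟨q₁, hq₁⟩ := (pathIn_map_iso (triRotIsoPow 3) (hTall 4 x4 hx4)).exists_walk
  obtain ⟨q₃, hq₃⟩ := (pathIn_map_iso (triRotIsoPow 3) (hTall 0 x0 hx0)).exists_walk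
  have hq₁' : ∀ z ∈ q₁.support, (n : ℤ) ≤ triNorm z ∧ triNorm z ≤ N ∧ z ∈ ωB := by
    intro z hz
    obtain ⟨u, hu, rfl⟩ := hq₁ z hz
    exact ⟨(annB 4 _ ⟨u, hu, rfl⟩).1, (annB 4 _ ⟨u, hu, rfl⟩).2, (colB u).2 (hTW 4 (by decide) u hu)⟩
  have hq₃' : ∀ z ∈ q₃.support, (n : ℤ) ≤ triNorm z ∧ triNorm z ≤ N ∧ z ∉ ωB := by
    intro z hz
    obtain ⟨u, hu, rfl⟩ := hq₃ z hz
    exact ⟨(annB 0 _ ⟨u, hu, rfl⟩).1, (annB 0 _ ⟨u, hu, rfl⟩).2, fun h => (colB u).1 h (hT0 u hu)⟩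
  obtain ⟨-, ⟨t40, t41⟩, -⟩ := rot134_apply (y 4)
  obtain ⟨-, ⟨t00, t01⟩, -⟩ := rot134_apply (y 0)
  obtain ⟨lB, hMB, hadjB, hPB, ⟨L₂B, hLB, hL₂B⟩, hmemB⟩ := FourArmFlip.exists_flipCycle hn hnN (ω := ωB) q₁ q₃
    (by rw [triNorm_rot]; exact hx4n) (by rw [triNorm_rot]; exact hx0n)
    (by rw [t40, t41]; omega) (by rw [triNorm_rot]; exact hyN 4) (by rw [t00]; omega)
    (by rw [triNorm_rot]; exact hyN 0) hq₁' hq₃'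
  have hmemB' : ∀ z ∈ lB, z ∈ triRotIsoPow 3 '' T 4 ∨ z ∈ triRotIsoPow 3 '' T 0 ∨ triNorm z < n ∨
      (triNorm z = N + 1 ∧ ((z 0 = -(N : ℤ) - 1 ∧ (triRotIsoPow 3 (y 0)) 1 ≤ z 1) ∨
        (z 1 = N + 1 ∧ -(N : ℤ) ≤ z 0 ∧ z 0 ≤ -1) ∨
        (1 ≤ z 0 ∧ z 0 ≤ (triRotIsoPow 3 (y 4)) 0 + 1 ∧ z 0 + z 1 = N + 1))) :=
    fun z hz => (hmemB z hz).imp (hq₁ z) fun h => h.imp (hq₃ z) id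
  have hP₁B : ∀ z ∈ triRotIsoPow 3 '' T 4, triNorm z ≤ N := fun z hz => (annB 4 z hz).2
  have hP₂B : ∀ z ∈ triRotIsoPow 3 '' T 0, triNorm z ≤ N := fun z hz => (annB 0 z hz).2
  have hringA_B : ∀ z ∈ lB, triNorm z = N + 1 → 1 ≤ z 0 → z 0 + z 1 = N + 1 := by
    intro z hz hzN hz0
    rcases hmemB' z hz with h | h | h | ⟨-, ⟨h, -⟩ | ⟨-, -, h⟩ | ⟨-, -, h⟩⟩
    · have := hP₁B z h; omega
    · have := hP₂B z h; omega
    · omega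
    · omega
    · omega
    · exact h
  -- the explored black chain of frame B: `ω`-white sites from side `4`
  obtain ⟨SBb, -, tBb, eBb, -, -, hSBb, -, heBb, -, htBb, -, hpBb, -⟩ :=
    explore_chains hnN hMB hadjB hPB hLB hL₂B hringA_B
  -- arms off the cycle of frame B are unexamined there
  have offB : ∀ j, j ≠ 4 → j ≠ 0 → ∀ v ∈ triRotIsoPow 3 '' T j, v ∉ faceVertex (startFace N) 2 :: lB := by
    intro j hj4 hj0 v hv
    exact not_mem_cycle₃_of_ann hmemB' (annB j v hv).1 (annB j v hv).2
      (not_mem_image_rot_of_disjoint (hTdisj j 4 hj4) hv) (not_mem_image_rot_of_disjoint (hTdisj j 0 hj0) hv)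
  have joinB : ∀ j, ∀ v ∈ triRotIsoPow 3 '' T j, PathIn triGraph (triRotIsoPow 3 '' T j) v (triRotIsoPow 3 (y j)) := by
    rintro j _ ⟨u, hu, rfl⟩
    exact pathIn_map_iso (triRotIsoPow 3) (hTall j u hu)
  have exB_of : ∀ j, (∀ v ∈ triRotIsoPow 3 '' T j, v ∉ examined n N ωB) → ∀ u ∈ T j, u ∉ examinedB n N ω := by
    intro j h u hu hex
    exact h _ ⟨u, hu, rfl⟩ (mem_examinedB.1 hex)
  -- arm 1: side 4 of frame B
  have hB1 : ∀ u ∈ T 1, u ∉ examinedB n N ω := by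
    obtain ⟨-, ⟨s0, s1⟩, -⟩ := rot134_apply (y 1)
    obtain ⟨he₁, he₂, had₁, had₂⟩ := escape_side4 (N := N) (y := triRotIsoPow 3 (y 1)) (by rw [s0, s1]; omega)
      (by rw [s0]; omega) (by rw [s0]; omega)
    exact exB_of 1 (not_mem_examined_of_escape hMB hadjB hPB hLB hL₂B (offB 1 (by decide) (by decide)) (joinB 1)
      (not_mem_cycle₃_of_ring hnN hP₁B hP₂B hmemB' he₁ (by simp; omega) (by simp; omega) (by simp; omega))
      he₂ had₁ had₂)
  -- arm 2: side 5 of frame B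
  have hB2 : ∀ u ∈ T 2, u ∉ examinedB n N ω := by
    obtain ⟨-, ⟨s0, s1⟩, -⟩ := rot134_apply (y 2)
    obtain ⟨he₁, he₂, had₁, had₂⟩ := escape_side5 (N := N) (y := triRotIsoPow 3 (y 2)) (by rw [s1]; omega)
      (by rw [s0]; omega) (by rw [s0]; omega)
    exact exB_of 2 (not_mem_examined_of_escape hMB hadjB hPB hLB hL₂B (offB 2 (by decide) (by decide)) (joinB 2)
      (not_mem_cycle₃_of_ring hnN hP₁B hP₂B hmemB' he₁ (by simp; omega) (by simp; omega) (by simp; omega))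
      he₂ had₁ had₂)
  -- arm 3: side 0 of frame B
  have hB3 : ∀ u ∈ T 3, u ∉ examinedB n N ω := by
    obtain ⟨-, ⟨s0, s1⟩, -⟩ := rot134_apply (y 3)
    obtain ⟨he₁, he₂, had₁, had₂⟩ := escape_side0 (N := N) (y := triRotIsoPow 3 (y 3)) (by rw [s0]; omega)
      (by rw [s1]; omega) (by rw [s1]; omega)
    exact exB_of 3 (not_mem_examined_of_escape hMB hadjB hPB hLB hL₂B (offB 3 (by decide) (by decide)) (joinB 3)
      (not_mem_cycle₃_of_ring hnN hP₁B hP₂B hmemB' he₁ (by simp; omega) (by simp; omega) (by simp; omega))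
      he₂ had₁ had₂)
  -- tight support of the chain, joined to its tip
  obtain ⟨Q, hQS, hQp, hQall⟩ := hpBb.exists_support
  have htBb0 : 0 ≤ tBb 0 ∧ tBb 0 ≤ N := by
    have h := triNorm_eq_of_apply_eq (y := tBb) rfl rfl
    omega
  obtain ⟨-, ⟨u0, u1⟩, -⟩ := rot134_apply tBb
  refine ⟨triRotIsoPow 3 '' Q, triRotIsoPow 3 eBb, triRotIsoPow 3 tBb, ?_, by rw [triNorm_rot]; exact heBb,
    by rw [triNorm_rot]; exact htBb.2.2, by rw [u0, u1]; omega, (pathIn_map_iso (triRotIsoPow 3) hQp).symm, ?_, ?_⟩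
  · rintro _ ⟨q, hq, rfl⟩
    obtain ⟨h1, h2, h3, h4⟩ := hSBb (hQS hq)
    exact ⟨by rw [hωB, mem_frameB] at h2; exact h2, mem_examinedB.2 (by rw [rot3_rot3]; exact h1),
      by rw [triNorm_rot]; exact h3, by rw [triNorm_rot]; exact h4⟩
  · rintro _ ⟨q, hq, rfl⟩
    exact pathIn_map_iso (triRotIsoPow 3) (hQall q hq).symm
  · intro j hj4 hj0
    fin_cases j
    · exact absurd rfl hj0
    · exact hB1
    · exact hB2
    · exact hB3
    · exact absurd rfl hj4

end Frames

/-- Pairwise disjointness of a family of five sets from the ten disjointness relations. [folklore] -/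
theorem pairwise_disjoint_five {α : Type*} {A : Fin 5 → Set α}
    (h01 : Disjoint (A 0) (A 1)) (h02 : Disjoint (A 0) (A 2)) (h03 : Disjoint (A 0) (A 3)) (h04 : Disjoint (A 0) (A 4))
    (h12 : Disjoint (A 1) (A 2)) (h13 : Disjoint (A 1) (A 3)) (h14 : Disjoint (A 1) (A 4))
    (h23 : Disjoint (A 2) (A 3)) (h24 : Disjoint (A 2) (A 4)) (h34 : Disjoint (A 3) (A 4)) :
    Pairwise fun i j => Disjoint (A i) (A j) := by
  intro i j hij
  fin_cases i <;> fin_cases j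
  all_goals first | exact absurd rfl hij | assumption | exact Disjoint.symm ‹_›

set_option maxHeartbeats 1600000 in
/-- **The double-exploration flip maps `landedOneFour n N` into `armEvent (B,W,B,B,W) n N`**
(`1 ≤ n ≤ N`). Frame A gives the examined black chain `Z₀` and white chain `Z₁` and leaves
`W(2), W(3), W(4)` unexamined; frame B gives the examined chain `Z₄` of white sites from side `4`
and leaves `W(1), W(2), W(3)` unexamined (`frameA_pack`, `frameB_pack`). The chain `Z₄` misses
`B(0)` (colour) and `W(1)` (examined in frame B versus unexamined), and escapes beyond side `5` of
frame A, so it is unexamined in frame A, hence disjoint from `Z₁`. After the flip: `Z₀` black,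
`Z₁` white, `W(2)`, `W(3)` black, `Z₄` white — five pairwise disjoint crossings of the annulus
(`mem_armEvent_of_disjointPaths`). [cite: Nolin2008, §5.1 Prop. 20 (arXiv 0711.4948: Prop. 19)] [cite: BollobasRiordan2006, Ch. 7 Lemma 6 and Claims 7–9 pp. 172–175] -/
theorem fiveArmFlip_mem_armEvent (hn : 1 ≤ n) (hnN : n ≤ N) {ω : SiteConfig (Site 2)} (hω : ω ∈ landedOneFour n N) :
    fiveArmFlip n N ω ∈ armEvent ![true, false, true, true, false] n N := by
  classical
  obtain ⟨S, x, y, hdisj, hann, hcol0, hcolW, hpath, hy0, hy1, hy2, hy3, hy4⟩ := hω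
  -- norms of the tips
  have hyN : ∀ j, triNorm (y j) = N := by
    intro j
    fin_cases j
    · show triNorm (y 0) = N; have h := triNorm_eq_of_apply_eq (y := y 0) rfl rfl; omega
    · show triNorm (y 1) = N; have h := triNorm_eq_of_apply_eq (y := y 1) rfl rfl; omega
    · show triNorm (y 2) = N; have h := triNorm_eq_of_apply_eq (y := y 2) rfl rfl; omega
    · show triNorm (y 3) = N; have h := triNorm_eq_of_apply_eq (y := y 3) rfl rfl; omega
    · show triNorm (y 4) = N; have h := triNorm_eq_of_apply_eq (y := y 4) rfl rfl; omega
  -- tight supports: every site joined inside the arm to its tip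
  have hT : ∀ j, ∃ T : Set (Site 2), T ⊆ S j ∧ PathIn triGraph T (x j) (y j) ∧ ∀ z ∈ T, PathIn triGraph T z (y j) := by
    intro j
    obtain ⟨T, hTS, hTp, hTall⟩ := (hpath j).2.symm.exists_support
    exact ⟨T, hTS, hTp.symm, fun z hz => (hTall z hz).symm⟩
  choose T hTS hTp hTall using hT
  have hTann : ∀ j, ∀ z ∈ T j, (n : ℤ) ≤ triNorm z ∧ triNorm z ≤ N := fun j z hz => hann j (hTS j hz)
  have hTdisj : ∀ i j, i ≠ j → ∀ z ∈ T i, z ∉ T j := fun i j hij z hzi hzj =>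
    Set.disjoint_left.1 (hdisj hij) (hTS i hzi) (hTS j hzj)
  have hT0 : ∀ z ∈ T 0, z ∈ ω := fun z hz => hcol0 z (hTS 0 hz)
  have hTW : ∀ j, j ≠ 0 → ∀ z ∈ T j, z ∉ ω := fun j hj z hz => hcolW j hj z (hTS j hz)
  have hxN : ∀ j, triNorm (x j) = n := fun j => (hpath j).1
  have hTne : ∀ j, ∃ x ∈ T j, triNorm x = n := fun j => ⟨x j, (hTp j).left_mem, hxN j⟩
  -- the two frames
  obtain ⟨Z0, Z1, e0, t0, e1, t1, c0, c1, he0, ht0, he1, ht1, hp0, hp1, hA, esc5⟩ :=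
    frameA_pack hn hnN hTann hTdisj hT0 hTW hTne hTall hyN hy0 hy1 hy2 hy3 hy4
  obtain ⟨Z4, e4, t4, c4, he4, ht4, ht4s, hp4, hZ4all, hB⟩ :=
    frameB_pack hn hnN hTann hTdisj hT0 hTW hTne hTall hyN hy0 hy1 hy2 hy3 hy4
  -- the chain of frame B is unexamined in frame A
  have hZ4A : ∀ z ∈ Z4, z ∉ examinedA n N ω := by
    obtain ⟨⟨s0, s1⟩, -, -⟩ := rot134_apply t4
    have key := esc5 (triRotIsoPow 1 '' Z4) (triRotIsoPow 1 t4) (by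
        rintro _ ⟨z, hz, rfl⟩
        obtain ⟨hzω, hzB, hz1, hz2⟩ := c4 z hz
        refine ⟨by rw [triNorm_rot]; exact hz1, by rw [triNorm_rot]; exact hz2, ?_, ?_⟩
        · rintro ⟨u, hu, huz⟩
          rw [(triRotIsoPow 1).injective huz] at hu
          exact hzω (hT0 z hu)
        · rintro ⟨u, hu, huz⟩
          rw [(triRotIsoPow 1).injective huz] at hu
          exact hB 1 (by decide) (by decide) z hu hzB)
      (by rintro _ ⟨z, hz, rfl⟩; exact pathIn_map_iso (triRotIsoPow 1) (hZ4all z hz))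
      (by rw [s1]; omega) (by rw [s0]; omega) (by rw [s0]; omega)
    intro z hz hex
    exact key _ ⟨z, hz, rfl⟩ (mem_examinedA.1 hex)
  -- colours after the flip
  have memAnn : ∀ z : Site 2, (n : ℤ) ≤ triNorm z → triNorm z ≤ N → z ∈ triAnnulus n N := fun z h1 h2 =>
    mem_triAnnulus.2 ⟨h1, h2⟩
  have exA_sub : ∀ z, z ∈ examinedA n N ω → z ∈ examinedAB n N ω := fun z hz => by
    rw [examinedAB, Finset.mem_union]; exact Or.inl hz
  have exB_sub : ∀ z, z ∈ examinedB n N ω → z ∈ examinedAB n N ω := fun z hz => by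
    rw [examinedAB, Finset.mem_union]; exact Or.inr hz
  have hex2 : ∀ z ∈ T 2, z ∉ examinedAB n N ω := fun z hz h => by
    rw [examinedAB, Finset.mem_union] at h
    exact h.elim (hA 2 (by decide) (by decide) z hz) (hB 2 (by decide) (by decide) z hz)
  have hex3 : ∀ z ∈ T 3, z ∉ examinedAB n N ω := fun z hz h => by
    rw [examinedAB, Finset.mem_union] at h
    exact h.elim (hA 3 (by decide) (by decide) z hz) (hB 3 (by decide) (by decide) z hz)
  have f0 : ∀ z ∈ Z0, z ∈ fiveArmFlip n N ω := fun z hz =>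
    (mem_fiveArmFlip_iff_of_mem (exA_sub _ (c0 z hz).2.1)).2 (c0 z hz).1
  have f1 : ∀ z ∈ Z1, z ∉ fiveArmFlip n N ω := fun z hz h =>
    (c1 z hz).1 ((mem_fiveArmFlip_iff_of_mem (exA_sub _ (c1 z hz).2.1)).1 h)
  have f2 : ∀ z ∈ T 2, z ∈ fiveArmFlip n N ω := fun z hz =>
    (mem_fiveArmFlip_iff_of_not_mem (memAnn z (hTann 2 z hz).1 (hTann 2 z hz).2) (hex2 z hz)).2 (hTW 2 (by decide) z hz)
  have f3 : ∀ z ∈ T 3, z ∈ fiveArmFlip n N ω := fun z hz =>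
    (mem_fiveArmFlip_iff_of_not_mem (memAnn z (hTann 3 z hz).1 (hTann 3 z hz).2) (hex3 z hz)).2 (hTW 3 (by decide) z hz)
  have f4 : ∀ z ∈ Z4, z ∉ fiveArmFlip n N ω := fun z hz h =>
    (c4 z hz).1 ((mem_fiveArmFlip_iff_of_mem (exB_sub _ (c4 z hz).2.1)).1 h)
  -- assemble
  refine mem_armEvent_of_disjointPaths (![true, false, true, true, false] : Fin 5 → Bool) ![Z0, Z1, T 2, T 3, Z4]
    (pairwise_disjoint_five ?_ ?_ ?_ ?_ ?_ ?_ ?_ ?_ ?_ ?_) ?_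
  · exact Set.disjoint_left.2 fun z h0 h1 => (c1 z h1).1 (c0 z h0).1
  · exact Set.disjoint_left.2 fun z h0 h2 => hex2 z h2 (exA_sub _ (c0 z h0).2.1)
  · exact Set.disjoint_left.2 fun z h0 h3 => hex3 z h3 (exA_sub _ (c0 z h0).2.1)
  · exact Set.disjoint_left.2 fun z h0 h4 => (c4 z h4).1 (c0 z h0).1
  · exact Set.disjoint_left.2 fun z h1 h2 => hex2 z h2 (exA_sub _ (c1 z h1).2.1)
  · exact Set.disjoint_left.2 fun z h1 h3 => hex3 z h3 (exA_sub _ (c1 z h1).2.1)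
  · exact Set.disjoint_left.2 fun z h1 h4 => hZ4A z h4 (c1 z h1).2.1
  · exact Set.disjoint_left.2 fun z h2 h3 => hTdisj 2 3 (by decide) z h2 h3
  · exact Set.disjoint_left.2 fun z h2 h4 => hex2 z h2 (exB_sub _ (c4 z h4).2.1)
  · exact Set.disjoint_left.2 fun z h3 h4 => hex3 z h3 (exB_sub _ (c4 z h4).2.1)
  · intro j
    fin_cases j
    · refine ⟨e0, t0, he0, ht0, hp0.mono ?_⟩
      intro z hz
      exact ⟨⟨hz, mem_triAnnSet.2 ⟨(c0 z hz).2.2.1, (c0 z hz).2.2.2⟩⟩, iff_of_true (f0 z hz) rfl⟩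
    · refine ⟨e1, t1, he1, ht1, hp1.mono ?_⟩
      intro z hz
      exact ⟨⟨hz, mem_triAnnSet.2 ⟨(c1 z hz).2.2.1, (c1 z hz).2.2.2⟩⟩, iff_of_false (f1 z hz) Bool.false_ne_true⟩
    · refine ⟨x 2, y 2, hxN 2, hyN 2, (hTp 2).mono ?_⟩
      intro z hz
      exact ⟨⟨hz, mem_triAnnSet.2 (hTann 2 z hz)⟩, iff_of_true (f2 z hz) rfl⟩
    · refine ⟨x 3, y 3, hxN 3, hyN 3, (hTp 3).mono ?_⟩
      intro z hz
      exact ⟨⟨hz, mem_triAnnSet.2 (hTann 3 z hz)⟩, iff_of_true (f3 z hz) rfl⟩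
    · refine ⟨e4, t4, he4, ht4, hp4.mono ?_⟩
      intro z hz
      exact ⟨⟨hz, mem_triAnnSet.2 ⟨(c4 z hz).2.2.1, (c4 z hz).2.2.2⟩⟩, iff_of_false (f4 z hz) Bool.false_ne_true⟩

/-! ### A fenced arm contains a landed arm of the annulus -/

/-- **A fenced open arm contains a landed open arm of the annulus.** For `1 ≤ m`, `2m ≤ N`,
`8 ≤ N`: the joining path of `sepOpenArmIn X m N`, from its last site of `Λ̊_m` to its first exit
from `Λ_N`, is an open path of `X ∩ {m ≤ |·| ≤ N}` from a site of `∂Λ_m` to a site `a` adjacent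
to the attaching ball `S̊_{N/8}(z)` at the landing site `z`, hence strictly inside side `0` of
`∂Λ_N`: `a₀ = N`, `-N < a₁ < 0`. [cite: Nolin2008, §4.2 Def. 6–8 (arXiv 0711.4948)] -/
theorem sepOpenArmIn_landed {m N : ℕ} {X : Set (Site 2)} {φ : SiteConfig (Site 2)} (h1 : 1 ≤ m)
    (hmN : 2 * m ≤ N) (h8 : 8 ≤ N) (h : φ ∈ sepOpenArmIn X m N) :
    ∃ (A : Set (Site 2)) (b a : Site 2), A ⊆ X ∧ (∀ v ∈ A, (m : ℤ) ≤ triNorm v ∧ triNorm v ≤ N ∧ v ∈ φ) ∧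
      triNorm b = m ∧ PathIn triGraph A b a ∧ a 0 = N ∧ -(N : ℤ) < a 1 ∧ a 1 < 0 := by
  obtain ⟨z, z', u, u', hz, hz', ⟨b₀, t₀, -, -, pu, -⟩, ⟨b₁, t₁, -, -, pu', -⟩, P⟩ := h
  have hu : triNorm u < m := triNorm_lt_of_mem_sepInnerFence hz' pu.right_mem.1.1
  have hu' : (N : ℤ) < triNorm u' := lt_triNorm_of_mem_sepOuterFence pu'.right_mem.1.1
  have hmN' : (m : ℤ) ≤ N := by omega
  -- last site of the open ball `Λ̊_m`
  obtain ⟨a₀, b, ha₀, -, hb, hab, Q⟩ :=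
    P.last_exit (C := {v : Site 2 | triNorm v < m}) hu (by simp only [mem_setOf_eq, not_lt]; omega)
  simp only [mem_setOf_eq, not_lt] at ha₀ hb
  have hbm : triNorm b = m := by
    have := triNorm_le_triNorm_add_one_of_adj hab
    change triNorm a₀ < m at ha₀
    omega
  -- first exit from `Λ_N`
  obtain ⟨a, b', ha, hb', hb'A, hab', Q'⟩ :=
    Q.exit (R := {v : Site 2 | triNorm v ≤ N}) (by simp only [mem_setOf_eq]; omega) (by simp only [mem_setOf_eq, not_le]; exact hu')
  simp only [mem_setOf_eq, not_le] at ha hb'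
  obtain ⟨⟨⟨hb'J, -⟩, -⟩, -⟩ := hb'A
  -- `b'` lies in the attaching ball at `z`
  have hz1 := mem_sepLanding.1 hz
  have hz'1 := mem_sepLanding.1 hz'
  have hb'z : triNorm (b' - z) < (N / 8 : ℕ) := by
    rcases hb'J with (h | h) | h
    · exact absurd h.2 (by omega)
    · exact h
    · exfalso
      rw [mem_triOpenBall] at h
      have h₁ := triNorm_add_le (b' - z') z'
      rw [sub_add_cancel] at h₁
      have h₂ : triNorm z' = m := by
        have := triNorm_eq_of_apply_eq (y := z') rfl rfl
        omega
      omega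
  -- coordinates of `a`
  have haN : triNorm a = N := by
    have := triNorm_le_triNorm_add_one_of_adj hab'
    omega
  obtain ⟨c0, c1, -⟩ := abs_le_triNorm (b' - z)
  simp only [Pi.sub_apply] at c0 c1
  obtain ⟨c0a, c0b⟩ := abs_le.1 c0
  obtain ⟨c1a, c1b⟩ := abs_le.1 c1
  have hadj := (triGraph_adj_iff_coord a b').1 hab'
  have hna := triNorm_eq_of_apply_eq (y := a) rfl rfl
  refine ⟨{v | triNorm v ≤ N} ∩ ((sepJoinRegion m N z z' ∩ X ∩ φ) \ {v | triNorm v < m}), b, a,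
    fun v hv => hv.2.1.1.2, fun v hv => ⟨?_, hv.1, hv.2.1.2⟩, hbm, Q', ?_, ?_, ?_⟩
  · have := hv.2.2; simp only [mem_setOf_eq, not_lt] at this; exact this
  · omega
  · omega
  · omega

/-- **`sepArms (B,W,W,W,W) m N ⊆ landedOneFour m N`** (`4 ≤ m`, `2m ≤ N`): each fenced arm of
the well-separated event, read back from its frame, contains a landed arm of its colour strictly
inside its side (`sepOpenArmIn_landed`); the white arms are disjoint by their carriers, the black
arm is disjoint from them by colour. [cite: Nolin2008, §4.2 Def. 6–8 and §5.1 Prop. 20 (arXiv 0711.4948: Prop. 19)] -/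
theorem sepArms_subset_landedOneFour {m N : ℕ} (h4 : 4 ≤ m) (hmN : 2 * m ≤ N) :
    sepArms ![true, false, false, false, false] m N ⊆ landedOneFour m N := by
  rintro ω ⟨X, hX, hA⟩
  set κ : Fin 5 → Bool := ![true, false, false, false, false] with hκ
  have key : ∀ j : Fin 5, ∃ (S : Set (Site 2)) (x y : Site 2), S ⊆ X j ∧
      (∀ v ∈ S, (m : ℤ) ≤ triNorm v ∧ triNorm v ≤ N ∧ (v ∈ ω ↔ κ j)) ∧ triNorm x = m ∧
      PathIn triGraph S x y ∧ ∃ a : Site 2, y = triRotIsoPow j.val a ∧ a 0 = N ∧ -(N : ℤ) < a 1 ∧ a 1 < 0 := by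
    intro j
    obtain ⟨A, b, a, hAX, hA', hb, hP, ha0, ha1, ha1'⟩ :=
      sepOpenArmIn_landed (by omega) hmN (by omega) (mem_sepArmAt.1 (hA j))
    refine ⟨triRotIsoPow j.val '' A, triRotIsoPow j.val b, triRotIsoPow j.val a, ?_, ?_,
      by rw [triNorm_rot]; exact hb, pathIn_map_iso _ hP, a, rfl, ha0, ha1, ha1'⟩
    · rintro _ ⟨v, hv, rfl⟩; exact hAX hv
    · rintro _ ⟨v, hv, rfl⟩
      obtain ⟨e1, e2, e3⟩ := hA' v hv
      exact ⟨by rw [triNorm_rot]; exact e1, by rw [triNorm_rot]; exact e2, mem_readFrame.1 e3⟩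
  choose S x y hSX hS hx hP a hya ha0 ha1 ha1' using key
  have hcol : ∀ j, j ≠ 0 → ∀ v ∈ S j, v ∉ ω := by
    intro j hj v hv h
    have := ((hS j v hv).2.2).1 h
    fin_cases j
    · exact hj rfl
    all_goals simp [hκ] at this
  refine ⟨S, x, y, ?_, fun j v hv => ⟨(hS j v hv).1, (hS j v hv).2.1⟩,
    fun v hv => ((hS 0 v hv).2.2).2 (by simp [hκ]), hcol, fun j => ⟨hx j, hP j⟩, ?_, ?_, ?_, ?_, ?_⟩
  · intro i j hij
    rw [Set.disjoint_left]
    intro v hvi hvj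
    by_cases hc : κ i = κ j
    · exact Set.disjoint_left.1 (hX i j hij hc) (hSX i hvi) (hSX j hvj)
    · exact hc (Bool.eq_iff_iff.2 (((hS i v hvi).2.2).symm.trans (hS j v hvj).2.2))
  · have h := hya 0; have e0 := ha0 0; have e1 := ha1 0; have e2 := ha1' 0
    obtain ⟨f0, f1, -⟩ := rot_apply_formula (a 0)
    simp only [Fin.val_zero] at h
    rw [h, f0, f1]; exact ⟨e0, e1, e2⟩
  · have h := hya 1; have e0 := ha0 1; have e1 := ha1 1; have e2 := ha1' 1
    obtain ⟨-, -, f0, f1, -⟩ := rot_apply_formula (a 1)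
    simp only [Fin.val_one] at h
    rw [h, f0, f1]; exact ⟨by omega, by omega, by omega⟩
  · have h := hya 2; have e0 := ha0 2; have e1 := ha1 2; have e2 := ha1' 2
    obtain ⟨-, -, -, -, f0, f1, -⟩ := rot_apply_formula (a 2)
    simp only [Fin.val_two] at h
    rw [h, f0, f1]; exact ⟨by omega, by omega, by omega⟩
  · have h := hya 3; have e0 := ha0 3; have e1 := ha1 3; have e2 := ha1' 3
    obtain ⟨-, -, -, -, -, -, f0, f1, -⟩ := rot_apply_formula (a 3)
    have h3 : (3 : Fin 5).val = 3 := rfl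
    simp only [h3] at h
    rw [h, f0, f1]; exact ⟨by omega, by omega, by omega⟩
  · have h := hya 4; have e0 := ha0 4; have e1 := ha1 4; have e2 := ha1' 4
    obtain ⟨-, -, -, -, -, -, -, -, f0, f1, -⟩ := rot_apply_formula (a 4)
    have h4' : (4 : Fin 5).val = 4 := rfl
    simp only [h4'] at h
    rw [h, f0, f1]; exact ⟨by omega, by omega, by omega⟩

/-! ### Probabilities -/

/-- **`P_{1/2}(landedOneFour m N) ≤ π_{(B,W,B,B,W)}(m, N)`** (`1 ≤ m ≤ N`): the flip of
`FlipFiveArm.lean` maps the event into `armEvent (B,W,B,B,W) m N` and preserves `P_{1/2}`. [cite: Nolin2008, §5.1 Prop. 20 (arXiv 0711.4948: Prop. 19)] [cite: BollobasRiordan2006, Ch. 7 Lemma 6 p. 175] -/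
theorem real_landedOneFour_le_polyArmProb {m N : ℕ} (hm : 1 ≤ m) (hmN : m ≤ N) :
    (triSitePercolation half).real (landedOneFour m N) ≤ polyArmProb ![true, false, true, true, false] m N := by
  unfold polyArmProb
  rw [← real_preimage_fiveArmFlip (n := m) (N := N) (determinedBy_armEvent _ hmN)]
  exact measureReal_mono (fun ω hω => fiveArmFlip_mem_armEvent hm hmN hω) (measure_ne_top _ _)

/-- **Colour switching for five well-separated arms, probabilistic form**:
`P_{1/2}(sepArms (B,W,W,W,W) m N) ≤ π_{(B,W,B,B,W)}(m, N)` for `4 ≤ m`, `2m ≤ N` (Nolin: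
"`P̂(A_{j,σ}) ≍ P̂(A_{j,σ'})`" through the well-separated events of Thm. 11 — here the inequality
that is used for the five-arm exponent). [cite: Nolin2008, §5.1 Prop. 20 (arXiv 0711.4948: Prop. 19)] -/
theorem real_sepArms_oneFour_le_polyArmProb {m N : ℕ} (h4 : 4 ≤ m) (hmN : 2 * m ≤ N) :
    (triSitePercolation half).real (sepArms ![true, false, false, false, false] m N) ≤
      polyArmProb ![true, false, true, true, false] m N :=
  (measureReal_mono (sepArms_subset_landedOneFour h4 hmN) (measure_ne_top _ _)).trans
    (real_landedOneFour_le_polyArmProb (by omega) (by omega))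

end FiveArmFlip

end Literature.Probability.Percolation

end
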